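import Summits.AtomisticToContinuum.HydrodynamicLimit.Theses.JParityClosure
import Summits.AtomisticToContinuum.HydrodynamicLimit.Theorems.LambertianContactSwapSwapGapGibbsDomination
import Summits.AtomisticToContinuum.HydrodynamicLimit.Theorems.RateFloor.Negative.WithoutEtaPos
import Summits.AtomisticToContinuum.HydrodynamicLimit.Theorems.RateFloor.Negative.RAfterN
import Literature.Analysis.FluidPDE.InfiniteHardSphereDynamics
import Literature.Analysis.FluidPDE.PalmLocalState
import HarnessLib

/-!
# Line `stationary-limit-no-screening` for crux `JParityClosure.RateFloor` (stmt-AtomisticToContinuum-13080)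

Crux-plan skeleton (planner-cruxplan-stmt-AtomisticToContinuum-13080-stationary-limit-no--0, 2026-08-16) of the crux
idea `Cruxes/RateFloor/Ideas/stationary-limit-no-screening.md` (ideator 2; triage r1-1/r1-2/r1-3: pass, with
sharpenings all acted on below).  Line card: `Lines/stationary-limit-no-screening.md`.

## The line in one paragraph

PASS TO THE LIMIT OBJECT AT THE KINETIC SCALE.  At the kinetic mollification scale `R_N = lam·(N+1)^{-1/3}`
(`= (lam/σ)·ε_N`, i.e. `L := lam/σ` particle diameters) BOTH functionals of the crux are LOCAL functionals of the
configuration seen from a typical space-time point of `supp χ` at the particle scale: `σ³B^Ξ_{R_N}(s,x) =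
σ⁻³·pairFunctional_L(localConfig_x(z(s)))` and `σ³ρ_{R_N}(x) = localDensity_L(·)` EXACTLY, and the collision
functional `K_N[χΞ]` is `σ⁻³·(∫χ)×` the rooted collision intensity of the χ-weighted local PATH law.  Conditioning
on a deficit event of probability `≥ δ` keeps the relative entropy of the initial law extensive, so along a deficit
subsequence the χ-weighted local laws have subsequential finite-dimensional-distribution limits `(P, Ψ)` that are
translation-invariant, STATIONARY hard-sphere states of finite intensity / energy / ENTROPY DENSITY (OVY's local
ergodic lemma §4 — `stub_stationaryLimit` — over the a.e. regular finite-cluster dynamics of finite-entropy states, Alexander ⊕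
OVY §3 — `stub_finiteEntropyDynamics`) on which the deficit survives in the
mean: `collisionRate < g₀·idealRate` — `stub_functionalLimits` (lower semicontinuity of the rooted collision
intensity, continuity of the ideal pair functional).  The line's bet `stub_noScreening` (a one-sided, kinematic
shadow of the Boltzmann hypothesis: NO dilute stationary finite-entropy state SCREENS collisions,
`collisionRate ≥ g⋆·idealRate` with `g⋆` independent of the entropy bound) then contradicts it.  This proves the
ENTROPY-CLASS, CUT, KINETIC-SCALE floor; the local-Gibbs floor follows from the tree's entropy budget
(`exists_localGibbsLaw_dominated`), the cut is removed by the dense complement `stub_denseComplementKinetic`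
(triage N1: every uncut kinetic statement is false in the entropy class), and the filed `r`-scale crux follows by
the lead c4's PROVED split `RateFloorKinetic → SubgridDomination → RateFloor` (copied from `Lines/SketchSplit.lean`),
`stub_subgridDomination` being the `r`-step every line for this crux owes (triage (R)).

## Registered stubs (6) and the composition

* S1 `stub_subgridDomination` — c4's `SubgridDomination` VERBATIM (shared `r`-step, open-problem grade).
* S2 `stub_denseComplementKinetic` — kinetic-scale dense complement under local-Gibbs flows (size L).
* S3♭ `stub_finiteEntropyDynamics` — Alexander ⊕ OVY §3: a.e. regular finite-cluster dynamics for TI finite-entropy states (XL, charted).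
* S3 `stub_stationaryLimit` — OVY Lemma 4.1–4.3 for hard spheres, GIVEN S3♭: fdd-subsequential limits of χ-weighted local
  laws of entropy-class laws (restricted to events of mass `≥ δ`) exist and are ADMISSIBLE stationary states (XL, charted).
* S4 `stub_functionalLimits` — identification: the two functionals pass to such a limit with the deficit (L).
* S5 `stub_noScreening` — `StationaryNoScreening(η₀)` at kinetic scale `L ≥ L₀` (HARDEST; the bet).
* `RateFloor_of : S1 → S2 → S3♭ → S3 → S4 → S5 → RateFloor` — PROVED below (logic, real arithmetic, union bounds, the
  entropy budget, countable choice; no sorry outside the six stubs).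

## Disproof used (`Cruxes/RateFloor/Disproof.lean` v6; Negative/WithoutEtaPos p73162, Negative/RAfterN p73513 — both imported)

`0 < η` is used in `entropyClassCutRateFloorKinetic_of_stationary` (the `χ ≡ 0` branch: the deficit event is EMPTY only
because `η > 0`; and S4's strict `<` comes from `η`).  The order `r` before `N` (here: `lam` fixed as `N → ∞`, so
`R_N/ε_N = lam/σ ≥ L₀` micro-diameters, `L₀ > 2` free in S5) is what makes `pairFunctional_L` non-trivial — the junk
regime `2R < ε_N` of `rateFloorRAfterN_holds` is `L < 2`, excluded by `L₀`.  No stub is an instance of either negative.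

## Lead c7 (prover-line-stmt-AtomisticToContinuum-13080-c7-0, 2026-08-17): wave-1 audit and reshape

Wave 1 (stub-workers on S3♭, S3, S4; S1, S2 inherit lead a1's typed `stub-blocked` audits; the lead holds S5) returned
`stub-blocked` × 3 with Lean-checked audits (attached to the item as evidence: `stub_finiteEntropyDynamics-analysis.md`,
`stub_stationaryLimit-analysis.md`, `stub_functionalLimits-analysis.md`).  Findings acted on HERE: (1) RESHAPE — the
finite-UNDIRECTED-cluster clause `∀ᵐ ω, HasFiniteClusters 1 ω (Ψ.traj ω)` is dropped from `IsAdmissible` and from S3♭ (see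
their docstrings: stronger than Alexander Prop 5.1, expected false on long windows by percolation, consumed by no arrow); the
composition is unchanged and still kernel-checked; (2) S4's dictionary is EXACT on good orbits (no constant/unit/orientation
off) and its second conjunct `idealRate < ⊤` is PROVED (`idealRate_lt_top_of_admissible`, lead folder
`work/stubs/stub_functionalLimits.lean`, def-carrying, lands with the LineDefs); (3) S3's normalisation is non-degenerate
(`fddLocalLaw_univ = chiMass·μ E ∈ (0,∞)`, `aemeasurable_fddMap`, Lean-checked); (4) typed missing facts: S3♭ ⇐
`AlexanderNonEquilibriumDynamics` (OPEN-grade for hard spheres in d = 3, not "charted"), S3 ⇐ OVY §4 Lemmas 4.1–4.3 for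
hard spheres ((0) Borel = count / Polish / compactness on `PointConfig`, (i) `exists_fdd_limit`, (ii) invariances + moments,
(iii) entropy density of the limit, (iv) `fdd_eq_flow` + `isStationary_of_fdd` — (iv) not in print), S4 ⇐ (i) continuity of
the cut ideal functional under `IsFddLimit` + velocity UI, (ii) l.s.c. of `collisionRate` incl. a uniform-in-N double-collision
bound, (iii) the finite-N Campbell identity via `empiricalCollisionMeasure`; S5 (lead): open — the bet (see `Lines/…dead.md`).
-/

noncomputable section

open scoped BigOperators Topology ENNReal NNReal InnerProductSpace RealInnerProductSpace Classical BoundedContinuousFunction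
open MeasureTheory Set Filter Function
open Literature.Analysis.FunctionSpaces Literature.Analysis.FluidPDE Literature.MathematicalPhysics.KineticTheory
open Summit.AtomisticToContinuum.HydrodynamicLimit.Theses.JParityClosure

namespace Summit.AtomisticToContinuum.HydrodynamicLimit.Cruxes.RateFloor.StationaryLimitNoScreening

/-! ## §1 LineDefs — the infinite-volume vocabulary of the line (to be landed by the lead as `Theorems/…LineDefs.lean`)

Micro units throughout: diameter `1`, configurations `ω : PointConfig (V3 × V3)` (position, velocity). -/

/-- Configurations of the infinite unit-diameter hard-sphere gas (abbreviation). [folklore] -/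
abbrev PC : Type := PointConfig (V3 × V3)

/-- The crux's cone mollifier `bx` in micro units: `3/(πL³)·(1 − ‖q‖/L)₊` (unit mass on `ℝ³`). [folklore] -/
def coneWeight (L : ℝ) (q : V3) : ℝ :=
  3 / (Real.pi * L ^ 3) * max (1 - ‖q‖ / L) 0

/-- The cone-mollified particle density of `ω` at the origin, scale `L`: `Σ_{(x,v) ∈ ω} coneWeight L x`.  At finite `N`
this is EXACTLY `σ³ρ_{R_N}` of the crux read on `localConfig` (`R_N = L·ε_N`, `(N+1)ε_N³ = σ³`). [folklore] -/
def localDensity (L : ℝ) (ω : PC) : ℝ :=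
  ω.sumFn fun p => coneWeight L p.1

/-- The crux's angular integral `Θ^Ξ(v,w) = ∫_{S²} Ξ(ω,v,w)·((w−v)·ω)₊ dω` (verbatim). [folklore] -/
def thetaMark (Ξ : V3 × V3 × V3 → ℝ) (v w : V3) : ℝ :=
  ∫ ω : Metric.sphere (0 : V3) 1, Ξ ((ω : V3), v, w) * hardSphereKernel (w, v) ω ∂sphereMeasure

/-- The IDEAL PAIR FUNCTIONAL at scale `L`: `Σ_{p,q ∈ ω} coneWeight L x_p · coneWeight L x_q · Θ^Ξ(v_p, v_q)` (the diagonal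
carries `Θ^Ξ(v,v) = 0`).  At finite `N`: `σ³·B^Ξ_{R_N}(s,x) = σ⁻³·pairFunctional L Ξ (localConfig_x z(s))` exactly. [folklore] -/
def pairFunctional (L : ℝ) (Ξ : V3 × V3 × V3 → ℝ) (ω : PC) : ℝ :=
  ω.sumFn fun p => coneWeight L p.1 * ω.sumFn fun q => coneWeight L q.1 * thetaMark Ξ p.2 q.2

/-- The CUT IDEAL RATE of a law `P` on configurations: `E_P[gc(localDensity_L) · pairFunctional_L^Ξ] ∈ [0,∞]`. [folklore] -/
def idealRate (P : Measure PC) (L : ℝ) (gc : ℝ → ℝ) (Ξ : V3 × V3 × V3 → ℝ) : ℝ≥0∞ :=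
  ∫⁻ ω, ENNReal.ofReal (gc (localDensity L ω) * pairFunctional L Ξ ω) ∂P

/-- The collision events `(p, t)` of the `Ψ`-orbit of `ω` (`collisionEvents`: particle label `p ∈ ω`, time `t`) with
`t ∈ (0,1]` whose particle sits in the unit cube at the collision instant (ROOTED collisions: an ordered count, each
physical collision appears once per partner in the cube — as in the crux's ordered double sum). [folklore] -/
def rootedCollisions (Ψ : InfiniteHardSphereFlow (Fin 3) 1) (ω : PC) : Set ((V3 × V3) × ℝ) :=
  {e | e ∈ collisionEvents 1 (ω : Set (V3 × V3)) (Ψ.traj ω) ∧ e.2 ∈ Set.Ioc (0 : ℝ) 1 ∧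
    (Ψ.traj ω e.1 e.2).1 ∈ Torus.unitCube (Fin 3)}

/-- The collision partner of the event `e = (p, t)` (unique by the `binary` clause of `IsInfiniteHardSphereTrajectory`;
`Classical.epsilon`, junk if `e` is not a collision event). [folklore] -/
def collisionPartner (Ψ : InfiniteHardSphereFlow (Fin 3) 1) (ω : PC) (e : (V3 × V3) × ℝ) : V3 × V3 :=
  Classical.epsilon fun q : V3 × V3 => q ∈ ω ∧ q ≠ e.1 ∧ ‖(Ψ.traj ω e.1 e.2).1 - (Ψ.traj ω q e.2).1‖ = 1

/-- The incoming (pre-collisional) velocity of particle `p` at time `t`: the left limit of its velocity path (velocities are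
right-continuous; the left limit exists at collision instants by the `binary` clause). [folklore] -/
def incomingVel (Ψ : InfiniteHardSphereFlow (Fin 3) 1) (ω : PC) (p : V3 × V3) (t : ℝ) : V3 :=
  Function.leftLim (fun s => (Ψ.traj ω p s).2) t

/-- The crux's cut mark of a rooted collision `e = (p,t)` with partner `q`: `gc(σ³ρ_{R_N}(x_p)) · Ξ(n̂, v_p⁻, v_q⁻)` with
`n̂ = x_p(t) − x_q(t)` (unit, from partner to root — the crux's `ε⁻¹·sepVec x_i x_j`) and the cut read on the configuration
AT the collision instant recentred at the root (`recentre`; `localDensity` then includes the root itself, exactly as the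
crux's `ρm z s (γ z s i).1`). [folklore] -/
def collisionMark (Ψ : InfiniteHardSphereFlow (Fin 3) 1) (L : ℝ) (gc : ℝ → ℝ) (Ξ : V3 × V3 × V3 → ℝ) (ω : PC)
    (e : (V3 × V3) × ℝ) : ℝ :=
  gc (localDensity L (recentre (Ψ.flow e.2 ω, Ψ.traj ω e.1 e.2))) *
    Ξ ((Ψ.traj ω e.1 e.2).1 - (Ψ.traj ω (collisionPartner Ψ ω e) e.2).1,
      incomingVel Ψ ω e.1 e.2, incomingVel Ψ ω (collisionPartner Ψ ω e) e.2)

/-- The CUT, MARKED ROOTED COLLISION INTENSITY of the state `P` under the flow `Ψ`: expected `gc·Ξ`-weight of rooted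
collisions per unit cube per unit micro-time, `∈ [0,∞]`.  For a stationary translation-invariant `(P, Ψ)` this is the
Palm/Campbell intensity of the marked collision point process; at finite `N`, `E[K_N[χ gc Ξ]] ≈ σ⁻³(∫χ)·collisionRate`
of the χ-weighted local path law. [folklore] -/
def collisionRate (Ψ : InfiniteHardSphereFlow (Fin 3) 1) (P : Measure PC) (L : ℝ) (gc : ℝ → ℝ)
    (Ξ : V3 × V3 × V3 → ℝ) : ℝ≥0∞ :=
  ∫⁻ ω, ∑' e : rootedCollisions Ψ ω, ENNReal.ofReal (collisionMark Ψ L gc Ξ ω e) ∂P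

/-- FINITE ENTROPY DENSITY `≤ h` relative to the ideal gas: for every Poisson–Maxwell reference law `Pref` (intensity
Lebesgue ⊗ standard Maxwellian, `maxwellPhaseMeasure 1 0 univ`; exists and is unique, `existsUnique_isPoissonPointProcess_holds`)
and every window radius `L`, the relative entropy of the window marginals is at most `h·L³` (OVY 1993 (2.2)(ii), §3:
the property of limit points of local laws of states with `O(N)` relative entropy; it EXCLUDES the singular collision-free
stationary states — combed / laned configurations with velocities enslaved to positions). [cite: OllaVaradhanYau1993, §2 (2.2)] -/
def HasEntropyDensityLE (h : ℝ) (P : Measure PC) : Prop :=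
  ∀ Pref : Measure PC, IsPoissonPointProcess (maxwellPhaseMeasure (1 : ℝ) (0 : V3) Set.univ) Pref →
    ∀ L : ℝ, 0 < L →
      InformationTheory.klDiv (P.map (PointConfig.restrict (Metric.closedBall (0 : V3) L ×ˢ (Set.univ : Set V3))))
          (Pref.map (PointConfig.restrict (Metric.closedBall (0 : V3) L ×ˢ (Set.univ : Set V3)))) ≤
        ENNReal.ofReal (h * L ^ 3)

/-- The ADMISSIBLE CLASS of the line: `(P, Ψ)` is a translation-invariant probability law on unit-diameter hard-sphere
configurations with a.e.-defined, STATIONARY infinite hard-sphere flow `Ψ` (Alexander's hypothesis structure — NOT the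
junk inhabitant: `IsAEDefined` forces `Ψ.good` to be conull, and orbits of good points solve the equations of motion),
a.e. translation covariance of the flow, finite intensity and kinetic-energy density, and FINITE ENTROPY DENSITY (some `h`).
Triage r1-1/r1-3 sharpening ("pin the flow") acted on.  RESHAPED by lead c7 (wave-1 audit of S3♭): the planner's clause
`∀ᵐ ω ∂P, HasFiniteClusters 1 ω (Ψ.traj ω)` — finiteness of the connected components of the UNDIRECTED "collided during
`[a,b]`" graph for ALL windows — is dropped: it is stronger than anything Alexander's Prop 5.1 (finite CAUSAL chains) gives,
it is expected to FAIL for every positive-intensity thermal state on long windows (percolation of the collision graph, mean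
degree `≍ ν_coll·(b−a) → ∞`), which would make the class trivial and S3 false for a silly reason, and no arrow of the
composition consumes it (S4/S5 take `IsAdmissible` opaquely; a.e. uniqueness, where needed inside S3, is Alexander
Thm 5.3-type regularity, not clusters). [folklore] -/
structure IsAdmissible (P : Measure PC) (Ψ : InfiniteHardSphereFlow (Fin 3) 1) : Prop where
  isProbabilityMeasure : IsProbabilityMeasure P
  isTranslationInvariant : IsTranslationInvariant P
  ae_isHardCore : ∀ᵐ ω ∂P, IsHardCore 1 ω
  isAEDefined : Ψ.IsAEDefined P
  isStationary : Ψ.IsStationary P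
  ae_covariant : ∀ a : V3, ∀ᵐ ω ∂P, ∀ t : ℝ, Ψ.flow t (ω.translate (a, 0)) = (Ψ.flow t ω).translate (a, 0)
  intensity_lt_top : intensity P < ⊤
  kineticEnergyDensity_lt_top : kineticEnergyDensity P < ⊤
  hasEntropyDensity : ∃ h : ℝ, HasEntropyDensityLE h P

/-- The χ-WEIGHTED FINITE-DIMENSIONAL LOCAL LAW of a finite system (OVY's `Q^ε` with a space-time weight and micro
time lags): the law of the `m`-tuple `(localConfig_x(Φ_{s + ε tᵢ} z))ᵢ` of configurations seen from `x` at scale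
`ε = ε_N`, under `χ(s,x)·1_{[0,τ]}(s) ds dx μ|_{hull E}(dz)` (un-normalised; `hull E = toMeasurable μ E`, so that
conditioning on a possibly non-measurable event is harmless).  A genuine push-forward for laws `μ ≪ Liouville`
(joint measurability of the flow on its good set, `HardSphereFlow.measurable_flow_prod'`, `measurable_localConfig`).
[cite: OllaVaradhanYau1993, §4 (4.1)] -/
def fddLocalLaw (σ : ℝ) (N : ℕ) (Φ : HardSphereFlow (Torus.geometry (Fin 3)) (hsDiameter σ N) (N + 1))
    (μ : Measure (Config (N + 1) (Fin 3) T3)) (E : Set (Config (N + 1) (Fin 3) T3)) (χ : ℝ × T3 → ℝ) (τ : ℝ)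
    {m : ℕ} (t : Fin m → ℚ) : Measure (Fin m → PC) :=
  ((((volume : Measure ℝ).restrict (Set.Icc 0 τ)).prod
      ((volume : Measure T3).prod (μ.restrict (toMeasurable μ E)))).withDensity
      fun p => ENNReal.ofReal (χ (p.1, p.2.1))).map
    fun p => fun i => localConfig (Torus.geometry (Fin 3)) (hsDiameter σ N) p.2.1
      (Φ.flow (p.1 + hsDiameter σ N * (t i : ℝ)) p.2.2)

/-- `(P, Ψ)` is the FDD LOCAL LIMIT of the finite systems `(n k, μ k, E k)` along `k → ∞`: for every finite family of
RATIONAL micro time lags and every bounded (vaguely) continuous functional of the tuple, the normalised χ-weighted fdd local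
laws converge to the law of `(Ψ_{tᵢ} ω)ᵢ`, `ω ∼ P` — convergence of finite-dimensional distributions of the local
configuration process to those of the stationary process `(P, Ψ)` (the seam between S3 and S4). [folklore] -/
def IsFddLimit (σ : ℝ) (Φ : (N : ℕ) → HardSphereFlow (Torus.geometry (Fin 3)) (hsDiameter σ N) (N + 1))
    (χ : ℝ × T3 → ℝ) (τ : ℝ) (n : ℕ → ℕ) (μ : (k : ℕ) → Measure (Config (n k + 1) (Fin 3) T3))
    (E : (k : ℕ) → Set (Config (n k + 1) (Fin 3) T3)) (P : Measure PC) (Ψ : InfiniteHardSphereFlow (Fin 3) 1) :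
    Prop :=
  ∀ (m : ℕ) (t : Fin m → ℚ) (F : (Fin m → PC) →ᵇ ℝ),
    Tendsto (fun k => ((fddLocalLaw σ (n k) (Φ (n k)) (μ k) (E k) χ τ t) Set.univ).toReal⁻¹ *
        ∫ w, F w ∂(fddLocalLaw σ (n k) (Φ (n k)) (μ k) (E k) χ τ t))
      atTop (𝓝 (∫ ω, F (fun i => Ψ.flow (t i : ℝ) ω) ∂P))

/-- The CUT KINETIC-SCALE DEFICIT EVENT of the crux: `{K_N[χ Ξ] < g₀σ³∫₀^τ∫ χ·gc(σ³ρ_{R_N})·B^Ξ_{R_N} − η}`,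
`R_N = lam·(N+1)^{-1/3}` — the crux's `let`-chain VERBATIM (as in c4's `RateFloorKinetic`) with the density cutoff `gc`
inserted on the IDEAL side only (the collision side stays uncut: `K[χΞ] ≥ K[χ gc Ξ]` anyway, and this is all the
composition needs). [folklore] -/
def cutDeficitEvent (σ : ℝ) (N : ℕ) (Φ : Literature.Analysis.FluidPDE.HardSphereFlow (Literature.Analysis.FluidPDE.Torus.geometry (Fin 3)) (Literature.MathematicalPhysics.KineticTheory.hsDiameter σ N) (N + 1)) (τ : ℝ) (χ : ℝ × UnitAddTorus (Fin 3) → ℝ) (gc : ℝ → ℝ) (Ξ : EuclideanSpace ℝ (Fin 3) × EuclideanSpace ℝ (Fin 3) × EuclideanSpace ℝ (Fin 3) → ℝ) (g₀ η lam : ℝ) : Set (Literature.Analysis.FluidPDE.Config (N + 1) (Fin 3) Literature.MathematicalPhysics.KineticTheory.T3) :=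
  {z₀ | let r : ℝ := lam * ((N + 1 : ℕ) : ℝ) ^ (-(1 / 3 : ℝ)); let ε := Literature.MathematicalPhysics.KineticTheory.hsDiameter σ N; let G := Literature.Analysis.FluidPDE.Torus.geometry (Fin 3); let γ := fun z (s : ℝ) => Φ.flow s z; let bx : UnitAddTorus (Fin 3) → UnitAddTorus (Fin 3) → ℝ := fun x y => 3 / (Real.pi * r ^ 3) * max (1 - Literature.Analysis.FluidPDE.Torus.euclidDist x y / r) 0; let ρm := fun z s (x₀ : UnitAddTorus (Fin 3)) => ∫ q, bx q.1 x₀ ∂(Literature.Analysis.FluidPDE.empiricalMeasure (γ z s)); let Θ := fun (Ξ : EuclideanSpace ℝ (Fin 3) × EuclideanSpace ℝ (Fin 3) × EuclideanSpace ℝ (Fin 3) → ℝ) (v w : EuclideanSpace ℝ (Fin 3)) => ∫ ω : Metric.sphere (0 : EuclideanSpace ℝ (Fin 3)) 1, Ξ ((ω : EuclideanSpace ℝ (Fin 3)), v, w) * Literature.MathematicalPhysics.KineticTheory.hardSphereKernel (w, v) ω ∂Literature.MathematicalPhysics.KineticTheory.sphereMeasure; let B := fun Ξ z s (x₀ : UnitAddTorus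 (Fin 3)) => ∫ p, bx p.1.1 x₀ * bx p.2.1 x₀ * Θ Ξ p.1.2 p.2.2 ∂((Literature.Analysis.FluidPDE.empiricalMeasure (γ z s)).prod (Literature.Analysis.FluidPDE.empiricalMeasure (γ z s))); let pv := fun z s (i j : Fin (N + 1)) => Literature.Analysis.FluidPDE.reflectVel (G.sepVec (γ z s i).1 (γ z s j).1) ((γ z s i).2, (γ z s j).2); let Kc := fun (Fn : Literature.Analysis.FluidPDE.Config (N + 1) (Fin 3) Literature.MathematicalPhysics.KineticTheory.T3 → ℝ → Fin (N + 1) → Fin (N + 1) → ℝ) z => ε / (N + 1 : ℝ) * ∑ᶠ (s : ℝ) (_ : s ∈ Literature.Analysis.FluidPDE.collisionTimes G ε (γ z) ∩ Set.Icc 0 τ), ∑ i : Fin (N + 1), ∑ j : Fin (N + 1), (if i ≠ j ∧ ‖G.sepVec (γ z s i).1 (γ z s j).1‖ = ε then Fn z s i j else 0); Kc (fun z s i j => χ (s, (γ z s i).1) * Ξ (ε⁻¹ • G.sepVec (γ z s i).1 (γ z s j).1, (pv z s i j).1, (pv z s i j).2)) z₀ < g₀ * σ ^ 3 * (∫ s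 in Set.Icc (0 : ℝ) τ, ∫ x : UnitAddTorus (Fin 3), χ (s, x) * gc (σ ^ 3 * ρm z₀ s x) * B Ξ z₀ s x) - η}

/-! ## §2 The finite-`N` statements: kinetic floor (c4), its cut / entropy-class forms, the split's `SubgridDomination` (c4) -/

/-- **`RateFloorKinetic`** (lead c4's restatement (a), text VERBATIM from `Lines/SketchSplit.lean` / `RESTATE.md`): the crux
mollified at the kinetic scale `R_N = lam·(N+1)^{-1/3}`, `∃g₀ ∀profiles ∃σ₀ ∀σ ∀Φ ∀τ ∀χ ∀Ξ ∀η δ ∃lam₀ ∀lam ∃N₀ ∀N`. [folklore] -/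
def RateFloorKinetic : Prop :=
  ∃ g₀ : ℝ, 0 < g₀ ∧ ∀ (a₀ θ₀ : Literature.MathematicalPhysics.KineticTheory.T3 → ℝ) (u₀ : Literature.MathematicalPhysics.KineticTheory.T3 → Literature.MathematicalPhysics.KineticTheory.V3), Continuous a₀ → Continuous θ₀ → Continuous u₀ → (∀ x, 0 < a₀ x) → (∀ x, 0 < θ₀ x) → ∃ σ₀ : ℝ, 0 < σ₀ ∧ ∀ σ : ℝ, 0 < σ → σ < σ₀ → ∀ Φ : (N : ℕ) → Literature.Analysis.FluidPDE.HardSphereFlow (Literature.Analysis.FluidPDE.Torus.geometry (Fin 3)) (Literature.MathematicalPhysics.KineticTheory.hsDiameter σ N) (N + 1), ∀ τ : ℝ, 0 < τ → ∀ χ : ℝ × UnitAddTorus (Fin 3) → ℝ, Continuous χ → (∀ p, 0 ≤ χ p) → ∀ Ξ : EuclideanSpace ℝ (Fin 3) × EuclideanSpace ℝ (Fin 3) × EuclideanSpace ℝ (Fin 3) → ℝ, Continuous Ξ → (∀ q, 0 ≤ Ξ q) → (∃ C : ℝ, ∀ q, Ξ q ≤ C) → ∀ η δ : ℝ, 0 <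 η → 0 < δ → ∃ lam₀ : ℝ, 0 < lam₀ ∧ ∀ lam : ℝ, lam₀ ≤ lam → ∃ N₀ : ℕ, ∀ N : ℕ, N₀ ≤ N → let r : ℝ := lam * ((N + 1 : ℕ) : ℝ) ^ (-(1 / 3 : ℝ)); let ε := Literature.MathematicalPhysics.KineticTheory.hsDiameter σ N; let G := Literature.Analysis.FluidPDE.Torus.geometry (Fin 3); let γ := fun z (s : ℝ) => (Φ N).flow s z; let bx : UnitAddTorus (Fin 3) → UnitAddTorus (Fin 3) → ℝ := fun x y => 3 / (Real.pi * r ^ 3) * max (1 - Literature.Analysis.FluidPDE.Torus.euclidDist x y / r) 0; let Θ := fun (Ξ : EuclideanSpace ℝ (Fin 3) × EuclideanSpace ℝ (Fin 3) × EuclideanSpace ℝ (Fin 3) → ℝ) (v w : EuclideanSpace ℝ (Fin 3)) => ∫ ω : Metric.sphere (0 : EuclideanSpace ℝ (Fin 3)) 1, Ξ ((ω : EuclideanSpace ℝ (Fin 3)), v, w) * Literature.MathematicalPhysics.KineticTheory.hardSphereKernel (w, v) ω ∂Literature.MathematicalPhysics.KineticTheory.sphereMeasure; let B := fun Ξ z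 s (x₀ : UnitAddTorus (Fin 3)) => ∫ p, bx p.1.1 x₀ * bx p.2.1 x₀ * Θ Ξ p.1.2 p.2.2 ∂((Literature.Analysis.FluidPDE.empiricalMeasure (γ z s)).prod (Literature.Analysis.FluidPDE.empiricalMeasure (γ z s))); let pv := fun z s (i j : Fin (N + 1)) => Literature.Analysis.FluidPDE.reflectVel (G.sepVec (γ z s i).1 (γ z s j).1) ((γ z s i).2, (γ z s j).2); let Kc := fun (Fn : Literature.Analysis.FluidPDE.Config (N + 1) (Fin 3) Literature.MathematicalPhysics.KineticTheory.T3 → ℝ → Fin (N + 1) → Fin (N + 1) → ℝ) z => ε / (N + 1 : ℝ) * ∑ᶠ (s : ℝ) (_ : s ∈ Literature.Analysis.FluidPDE.collisionTimes G ε (γ z) ∩ Set.Icc 0 τ), ∑ i : Fin (N + 1), ∑ j : Fin (N + 1), (if i ≠ j ∧ ‖G.sepVec (γ z s i).1 (γ z s j).1‖ = ε then Fn z s i j else 0); Literature.MathematicalPhysics.KineticTheory.localGibbsLaw σ a₀ u₀ θ₀ N (Φ N) {z | Kc (fun z s i j => χ (s, (γ z s i).1) * Ξ (ε⁻¹ •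 G.sepVec (γ z s i).1 (γ z s j).1, (pv z s i j).1, (pv z s i j).2)) z < g₀ * σ ^ 3 * (∫ s in Set.Icc (0 : ℝ) τ, ∫ x : UnitAddTorus (Fin 3), χ (s, x) * B Ξ z s x) - η} ≤ ENNReal.ofReal δ

/-- **`CutRateFloorKinetic η₀ g₀`**: the kinetic floor with constant `g₀` against the CUT ideal functional (continuous cutoffs
`0 ≤ gc ≤ 1` vanishing on `[η₀, ∞)`, as in items 13078/13079), for local-Gibbs flows: `∀profiles ∃σ₀ ∀… ∀gc ∀η δ ∃lam₀ ∀lam ∃N₀ ∀N`. [folklore] -/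
def CutRateFloorKinetic (η₀ g₀ : ℝ) : Prop :=
  ∀ (a₀ θ₀ : T3 → ℝ) (u₀ : T3 → V3), Continuous a₀ → Continuous θ₀ → Continuous u₀ → (∀ x, 0 < a₀ x) →
  (∀ x, 0 < θ₀ x) → ∃ σ₀ : ℝ, 0 < σ₀ ∧ ∀ σ : ℝ, 0 < σ → σ < σ₀ →
  ∀ Φ : (N : ℕ) → HardSphereFlow (Torus.geometry (Fin 3)) (hsDiameter σ N) (N + 1),
  ∀ τ : ℝ, 0 < τ → ∀ χ : ℝ × T3 → ℝ, Continuous χ → (∀ p, 0 ≤ χ p) →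
  ∀ Ξ : V3 × V3 × V3 → ℝ, Continuous Ξ → (∀ q, 0 ≤ Ξ q) → (∃ C : ℝ, ∀ q, Ξ q ≤ C) →
  ∀ gc : ℝ → ℝ, Continuous gc → (∀ a, 0 ≤ gc a) → (∀ a, gc a ≤ 1) → (∀ a, η₀ ≤ a → gc a = 0) →
  ∀ η δ : ℝ, 0 < η → 0 < δ → ∃ lam₀ : ℝ, 0 < lam₀ ∧ ∀ lam : ℝ, lam₀ ≤ lam → ∃ N₀ : ℕ, ∀ N : ℕ, N₀ ≤ N →
    localGibbsLaw σ a₀ u₀ θ₀ N (Φ N) (cutDeficitEvent σ N (Φ N) τ χ gc Ξ g₀ η lam) ≤ ENNReal.ofReal δ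

/-- **`EntropyClassCutRateFloorKinetic η₀ g₀`** — what the stationary-limit line actually proves: the cut kinetic floor
for EVERY initial probability law of relative entropy `≤ K(N+1)` with respect to the standard homogeneous Gibbs law
`G_N = localGibbsLaw σ 1 0 1` (`∃σ₀ ∀σ ∀Φ τ χ Ξ gc ∀K η δ ∃lam₀ ∀lam ∃N₀ ∀N ∀μ`).  Believed TRUE (unlike its uncut or
`r`-scale cousins: triage N1, c4's shear), and by S12-duality equivalent to the cut kinetic-scale super-exponential
equilibrium bound `E1_cut@R_N` of line L — the two lines prove the same intermediate by orthogonal means. [folklore] -/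
def EntropyClassCutRateFloorKinetic (η₀ g₀ : ℝ) : Prop :=
  ∃ σ₀ : ℝ, 0 < σ₀ ∧ ∀ σ : ℝ, 0 < σ → σ < σ₀ →
  ∀ Φ : (N : ℕ) → HardSphereFlow (Torus.geometry (Fin 3)) (hsDiameter σ N) (N + 1),
  ∀ τ : ℝ, 0 < τ → ∀ χ : ℝ × T3 → ℝ, Continuous χ → (∀ p, 0 ≤ χ p) →
  ∀ Ξ : V3 × V3 × V3 → ℝ, Continuous Ξ → (∀ q, 0 ≤ Ξ q) → (∃ C : ℝ, ∀ q, Ξ q ≤ C) →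
  ∀ gc : ℝ → ℝ, Continuous gc → (∀ a, 0 ≤ gc a) → (∀ a, gc a ≤ 1) → (∀ a, η₀ ≤ a → gc a = 0) →
  ∀ K η δ : ℝ, 0 < η → 0 < δ → ∃ lam₀ : ℝ, 0 < lam₀ ∧ ∀ lam : ℝ, lam₀ ≤ lam → ∃ N₀ : ℕ, ∀ N : ℕ, N₀ ≤ N →
    ∀ μ : Measure (Config (N + 1) (Fin 3) T3), IsProbabilityMeasure μ →
      InformationTheory.klDiv μ (localGibbsLaw σ (fun _ => (1 : ℝ)) (fun _ => (0 : V3)) (fun _ => (1 : ℝ)) N (Φ N)) ≤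
        ENNReal.ofReal (K * ((N : ℝ) + 1)) →
      μ (cutDeficitEvent σ N (Φ N) τ χ gc Ξ g₀ η lam) ≤ ENNReal.ofReal δ

/-! ## §3 The six registered stubs -/

/-- **S1 · `stub_subgridDomination` — THE SHARED `r`-STEP** (lead c4's `SubgridDomination`, text VERBATIM from
`Lines/SketchSplit.lean` so that every line registers the SAME statement).  Along the local-Gibbs hard-sphere flow the
`r`-mollified ideal pair functional is dominated in probability by a universal multiple `Cd` of the kinetic-scale one plus
`η` (`∃Cd ∀profiles ∃σ₀ ∀σ ∀Φ τ χ Ξ ∀η δ ∃r₀ ∀r ∃lam₀ ∀lam ∃N₀ ∀N`): no volume-filling sub-`r` DRIFT segregation of the local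
velocity law, for every `τ` (post-shock included).  Why it might fail: sustained volume-filling sub-`r` velocity segregation
(interpenetrating streams / shear lamellae at scales `(ℓ_N, r)`) with probability `> δ` from smooth local-Gibbs data; FALSE
for entropy-class data (c4's r-scale laminar shear, S13 p126421), plausible from continuous profiles (thermalisation within a
crossing time; Kolmogorov scaling) but beyond entropy/energy/stationarity — a regularity statement about the hydrodynamic
limit itself (triage (R), `SketchDead.md`).  The planner's conforming restatement (cut + kinetic scale, or `τ < T`) would
delete it.  Leans on: nothing landed; neighbours DensityCap (13082), KineticEnergyTails (13087). [size open-problem] -/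
def Stubs.stub_subgridDomination : Prop :=
  ∃ Cd : ℝ, 0 < Cd ∧ ∀ (a₀ θ₀ : Literature.MathematicalPhysics.KineticTheory.T3 → ℝ) (u₀ : Literature.MathematicalPhysics.KineticTheory.T3 → Literature.MathematicalPhysics.KineticTheory.V3), Continuous a₀ → Continuous θ₀ → Continuous u₀ → (∀ x, 0 < a₀ x) → (∀ x, 0 < θ₀ x) → ∃ σ₀ : ℝ, 0 < σ₀ ∧ ∀ σ : ℝ, 0 < σ → σ < σ₀ → ∀ Φ : (N : ℕ) → Literature.Analysis.FluidPDE.HardSphereFlow (Literature.Analysis.FluidPDE.Torus.geometry (Fin 3)) (Literature.MathematicalPhysics.KineticTheory.hsDiameter σ N) (N + 1), ∀ τ : ℝ, 0 < τ → ∀ χ : ℝ × UnitAddTorus (Fin 3) → ℝ, Continuous χ → (∀ p, 0 ≤ χ p) → ∀ Ξ : EuclideanSpace ℝ (Fin 3) × EuclideanSpace ℝ (Fin 3) × EuclideanSpace ℝ (Fin 3) → ℝ, Continuous Ξ → (∀ q, 0 ≤ Ξ q) → (∃ C : ℝ, ∀ q, Ξ q ≤ C) → ∀ η δ : ℝ,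 0 < η → 0 < δ → ∃ r₀ : ℝ, 0 < r₀ ∧ ∀ r : ℝ, 0 < r → r < r₀ → ∃ lam₀ : ℝ, 0 < lam₀ ∧ ∀ lam : ℝ, lam₀ ≤ lam → ∃ N₀ : ℕ, ∀ N : ℕ, N₀ ≤ N → let γ := fun z (s : ℝ) => (Φ N).flow s z; let bx : UnitAddTorus (Fin 3) → UnitAddTorus (Fin 3) → ℝ := fun x y => 3 / (Real.pi * r ^ 3) * max (1 - Literature.Analysis.FluidPDE.Torus.euclidDist x y / r) 0; let bxk : UnitAddTorus (Fin 3) → UnitAddTorus (Fin 3) → ℝ := fun x y => 3 / (Real.pi * (lam * ((N + 1 : ℕ) : ℝ) ^ (-(1 / 3 : ℝ))) ^ 3) * max (1 - Literature.Analysis.FluidPDE.Torus.euclidDist x y / (lam * ((N + 1 : ℕ) : ℝ) ^ (-(1 / 3 : ℝ)))) 0; let Θ := fun (Ξ : EuclideanSpace ℝ (Fin 3) × EuclideanSpace ℝ (Fin 3) × EuclideanSpace ℝ (Fin 3) → ℝ) (v w : EuclideanSpace ℝ (Fin 3)) => ∫ ω : Metric.sphere (0 : EuclideanSpace ℝ (Fin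 3)) 1, Ξ ((ω : EuclideanSpace ℝ (Fin 3)), v, w) * Literature.MathematicalPhysics.KineticTheory.hardSphereKernel (w, v) ω ∂Literature.MathematicalPhysics.KineticTheory.sphereMeasure; let B := fun Ξ z s (x₀ : UnitAddTorus (Fin 3)) => ∫ p, bx p.1.1 x₀ * bx p.2.1 x₀ * Θ Ξ p.1.2 p.2.2 ∂((Literature.Analysis.FluidPDE.empiricalMeasure (γ z s)).prod (Literature.Analysis.FluidPDE.empiricalMeasure (γ z s))); let Bk := fun Ξ z s (x₀ : UnitAddTorus (Fin 3)) => ∫ p, bxk p.1.1 x₀ * bxk p.2.1 x₀ * Θ Ξ p.1.2 p.2.2 ∂((Literature.Analysis.FluidPDE.empiricalMeasure (γ z s)).prod (Literature.Analysis.FluidPDE.empiricalMeasure (γ z s))); Literature.MathematicalPhysics.KineticTheory.localGibbsLaw σ a₀ u₀ θ₀ N (Φ N) {z | Cd * (∫ s in Set.Icc (0 : ℝ) τ, ∫ x : UnitAddTorus (Fin 3), χ (s, x) * Bk Ξ z s x) + η < (∫ s in Set.Icc (0 : ℝ) τ, ∫ x : UnitAddTorus (Fin 3), χ (s, x) * B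 Ξ z s x)} ≤ ENNReal.ofReal δ

/-- Registered stub S1 (`Stubs.stub_subgridDomination`, verbatim): the `sorry` to be discharged. -/
theorem stub_subgridDomination :
    ∃ Cd : ℝ, 0 < Cd ∧ ∀ (a₀ θ₀ : Literature.MathematicalPhysics.KineticTheory.T3 → ℝ) (u₀ : Literature.MathematicalPhysics.KineticTheory.T3 → Literature.MathematicalPhysics.KineticTheory.V3), Continuous a₀ → Continuous θ₀ → Continuous u₀ → (∀ x, 0 < a₀ x) → (∀ x, 0 < θ₀ x) → ∃ σ₀ : ℝ, 0 < σ₀ ∧ ∀ σ : ℝ, 0 < σ → σ < σ₀ → ∀ Φ : (N : ℕ) → Literature.Analysis.FluidPDE.HardSphereFlow (Literature.Analysis.FluidPDE.Torus.geometry (Fin 3)) (Literature.MathematicalPhysics.KineticTheory.hsDiameter σ N) (N + 1), ∀ τ : ℝ, 0 < τ → ∀ χ : ℝ × UnitAddTorus (Fin 3) → ℝ, Continuous χ → (∀ p, 0 ≤ χ p) → ∀ Ξ : EuclideanSpace ℝ (Fin 3) × EuclideanSpace ℝ (Fin 3) × EuclideanSpace ℝ (Fin 3) → ℝ, Continuous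 Ξ → (∀ q, 0 ≤ Ξ q) → (∃ C : ℝ, ∀ q, Ξ q ≤ C) → ∀ η δ : ℝ, 0 < η → 0 < δ → ∃ r₀ : ℝ, 0 < r₀ ∧ ∀ r : ℝ, 0 < r → r < r₀ → ∃ lam₀ : ℝ, 0 < lam₀ ∧ ∀ lam : ℝ, lam₀ ≤ lam → ∃ N₀ : ℕ, ∀ N : ℕ, N₀ ≤ N → let γ := fun z (s : ℝ) => (Φ N).flow s z; let bx : UnitAddTorus (Fin 3) → UnitAddTorus (Fin 3) → ℝ := fun x y => 3 / (Real.pi * r ^ 3) * max (1 - Literature.Analysis.FluidPDE.Torus.euclidDist x y / r) 0; let bxk : UnitAddTorus (Fin 3) → UnitAddTorus (Fin 3) → ℝ := fun x y => 3 / (Real.pi * (lam * ((N + 1 : ℕ) : ℝ) ^ (-(1 / 3 : ℝ))) ^ 3) * max (1 - Literature.Analysis.FluidPDE.Torus.euclidDist x y / (lam * ((N + 1 : ℕ) : ℝ) ^ (-(1 / 3 : ℝ)))) 0; let Θ := fun (Ξ : EuclideanSpace ℝ (Fin 3) × EuclideanSpace ℝ (Fin 3) × EuclideanSpace ℝ (Fin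 3) → ℝ) (v w : EuclideanSpace ℝ (Fin 3)) => ∫ ω : Metric.sphere (0 : EuclideanSpace ℝ (Fin 3)) 1, Ξ ((ω : EuclideanSpace ℝ (Fin 3)), v, w) * Literature.MathematicalPhysics.KineticTheory.hardSphereKernel (w, v) ω ∂Literature.MathematicalPhysics.KineticTheory.sphereMeasure; let B := fun Ξ z s (x₀ : UnitAddTorus (Fin 3)) => ∫ p, bx p.1.1 x₀ * bx p.2.1 x₀ * Θ Ξ p.1.2 p.2.2 ∂((Literature.Analysis.FluidPDE.empiricalMeasure (γ z s)).prod (Literature.Analysis.FluidPDE.empiricalMeasure (γ z s))); let Bk := fun Ξ z s (x₀ : UnitAddTorus (Fin 3)) => ∫ p, bxk p.1.1 x₀ * bxk p.2.1 x₀ * Θ Ξ p.1.2 p.2.2 ∂((Literature.Analysis.FluidPDE.empiricalMeasure (γ z s)).prod (Literature.Analysis.FluidPDE.empiricalMeasure (γ z s))); Literature.MathematicalPhysics.KineticTheory.localGibbsLaw σ a₀ u₀ θ₀ N (Φ N) {z | Cd * (∫ s in Set.Icc (0 : ℝ) τ, ∫ x : UnitAddTorus (Fin 3), χ (s, x) *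 Bk Ξ z s x) + η < (∫ s in Set.Icc (0 : ℝ) τ, ∫ x : UnitAddTorus (Fin 3), χ (s, x) * B Ξ z s x)} ≤ ENNReal.ofReal δ := by
  sorry

/-- **S2 · `stub_denseComplementKinetic` — THE DENSE DEBT AT THE KINETIC SCALE.**  For every threshold `η₀ > 0`: along
the local-Gibbs flow with continuous profiles and `σ < σ₀(profiles, η₀)`, for every `τ, χ, Ξ` and every continuous cutoff
`0 ≤ gc ≤ 1` EQUAL TO `1` ON `[0, η₀/2]`, the part of the kinetic-scale ideal functional removed by the cut,
`σ³(∫∫χ B_{R_N} − ∫∫χ gc(σ³ρ_{R_N}) B_{R_N})`, exceeds `η` with probability `≤ δ` (`∀η δ ∃lam₀ ∀lam ∃N₀ ∀N`).  I.e. the ideal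
weight carried by field points of kinetic-scale packing `≥ η₀/2` is negligible in probability: globally the gas has packing
`O(σ³) → 0`, a macroscopic mass at packing `≥ η₀/2` needs compression by `η₀/(σ³ max a₀) → ∞`, available only at
implosion foci of vanishing mass (pre-shock: `DiluteSelfConsistency` 3091 + `DensityCap` 13082); kinetic-scale Poisson
density fluctuations above `η₀/2` carry an exponentially small FRACTION of the weight once `lam ≥ lam₀(η, δ)`.  Why it might
fail: a focusing implosion or a dynamically nucleated jammed cluster holding mass `≳ σ³/η₀·η` at packing `≥ η₀/2` with
probability `> δ` at some `τ` (post-shock) — the disprover's cheapest live target for the filed uncut crux (triage r1-2/r1-3: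
DenseComplement), now isolated as ONE statement; necessary in some form for every line (triage N1: every UNCUT kinetic floor is
false in the entropy class).  Leans on: nothing landed; neighbours DensityCap (13082), DiluteSelfConsistency (3091),
`stub_rateFloorGAfterEta`'s packing bound `σ³∫B_r ≤ C·avg|v|` (p126309). [size L] -/
def Stubs.stub_denseComplementKinetic : Prop :=
  ∀ η₀ : ℝ, 0 < η₀ → ∀ (a₀ θ₀ : Literature.MathematicalPhysics.KineticTheory.T3 → ℝ) (u₀ : Literature.MathematicalPhysics.KineticTheory.T3 → Literature.MathematicalPhysics.KineticTheory.V3), Continuous a₀ → Continuous θ₀ → Continuous u₀ → (∀ x, 0 < a₀ x) → (∀ x, 0 < θ₀ x) → ∃ σ₀ : ℝ, 0 < σ₀ ∧ ∀ σ : ℝ, 0 < σ → σ < σ₀ → ∀ Φ : (N : ℕ) → Literature.Analysis.FluidPDE.HardSphereFlow (Literature.Analysis.FluidPDE.Torus.geometry (Fin 3)) (Literature.MathematicalPhysics.KineticTheory.hsDiameter σ N) (N + 1), ∀ τ : ℝ, 0 < τ → ∀ χ : ℝ × UnitAddTorus (Fin 3) → ℝ, Continuous χ → (∀ p, 0 ≤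 χ p) → ∀ Ξ : EuclideanSpace ℝ (Fin 3) × EuclideanSpace ℝ (Fin 3) × EuclideanSpace ℝ (Fin 3) → ℝ, Continuous Ξ → (∀ q, 0 ≤ Ξ q) → (∃ C : ℝ, ∀ q, Ξ q ≤ C) → ∀ gc : ℝ → ℝ, Continuous gc → (∀ a, 0 ≤ gc a) → (∀ a, gc a ≤ 1) → (∀ a, a ≤ η₀ / 2 → gc a = 1) → ∀ η δ : ℝ, 0 < η → 0 < δ → ∃ lam₀ : ℝ, 0 < lam₀ ∧ ∀ lam : ℝ, lam₀ ≤ lam → ∃ N₀ : ℕ, ∀ N : ℕ, N₀ ≤ N → let r : ℝ := lam * ((N + 1 : ℕ) : ℝ) ^ (-(1 / 3 : ℝ)); let γ := fun z (s : ℝ) => (Φ N).flow s z; let bx : UnitAddTorus (Fin 3) → UnitAddTorus (Fin 3) → ℝ := fun x y => 3 / (Real.pi * r ^ 3) * max (1 - Literature.Analysis.FluidPDE.Torus.euclidDist x y / r) 0; let ρm := fun z s (x₀ : UnitAddTorus (Fin 3)) => ∫ q, bx q.1 x₀ ∂(Literature.Analysis.FluidPDE.empiricalMeasure (γ z s)); let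 Θ := fun (Ξ : EuclideanSpace ℝ (Fin 3) × EuclideanSpace ℝ (Fin 3) × EuclideanSpace ℝ (Fin 3) → ℝ) (v w : EuclideanSpace ℝ (Fin 3)) => ∫ ω : Metric.sphere (0 : EuclideanSpace ℝ (Fin 3)) 1, Ξ ((ω : EuclideanSpace ℝ (Fin 3)), v, w) * Literature.MathematicalPhysics.KineticTheory.hardSphereKernel (w, v) ω ∂Literature.MathematicalPhysics.KineticTheory.sphereMeasure; let B := fun Ξ z s (x₀ : UnitAddTorus (Fin 3)) => ∫ p, bx p.1.1 x₀ * bx p.2.1 x₀ * Θ Ξ p.1.2 p.2.2 ∂((Literature.Analysis.FluidPDE.empiricalMeasure (γ z s)).prod (Literature.Analysis.FluidPDE.empiricalMeasure (γ z s))); Literature.MathematicalPhysics.KineticTheory.localGibbsLaw σ a₀ u₀ θ₀ N (Φ N) {z | η < σ ^ 3 * ((∫ s in Set.Icc (0 : ℝ) τ, ∫ x : UnitAddTorus (Fin 3), χ (s, x) * B Ξ z s x) - (∫ s in Set.Icc (0 : ℝ) τ, ∫ x : UnitAddTorus (Fin 3), χ (s, x) * gc (σ ^ 3 * ρm z s x)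 * B Ξ z s x))} ≤ ENNReal.ofReal δ

/-- Registered stub S2 (`Stubs.stub_denseComplementKinetic`, verbatim): the `sorry` to be discharged. -/
theorem stub_denseComplementKinetic :
    ∀ η₀ : ℝ, 0 < η₀ → ∀ (a₀ θ₀ : Literature.MathematicalPhysics.KineticTheory.T3 → ℝ) (u₀ : Literature.MathematicalPhysics.KineticTheory.T3 → Literature.MathematicalPhysics.KineticTheory.V3), Continuous a₀ → Continuous θ₀ → Continuous u₀ → (∀ x, 0 < a₀ x) → (∀ x, 0 < θ₀ x) → ∃ σ₀ : ℝ, 0 < σ₀ ∧ ∀ σ : ℝ, 0 < σ → σ < σ₀ → ∀ Φ : (N : ℕ) → Literature.Analysis.FluidPDE.HardSphereFlow (Literature.Analysis.FluidPDE.Torus.geometry (Fin 3)) (Literature.MathematicalPhysics.KineticTheory.hsDiameter σ N) (N + 1), ∀ τ : ℝ, 0 < τ → ∀ χ : ℝ × UnitAddTorus (Fin 3) → ℝ, Continuous χ → (∀ p, 0 ≤ χ p) → ∀ Ξ : EuclideanSpace ℝ (Fin 3) × EuclideanSpace ℝ (Fin 3) × EuclideanSpace ℝ (Fin 3) → ℝ,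 Continuous Ξ → (∀ q, 0 ≤ Ξ q) → (∃ C : ℝ, ∀ q, Ξ q ≤ C) → ∀ gc : ℝ → ℝ, Continuous gc → (∀ a, 0 ≤ gc a) → (∀ a, gc a ≤ 1) → (∀ a, a ≤ η₀ / 2 → gc a = 1) → ∀ η δ : ℝ, 0 < η → 0 < δ → ∃ lam₀ : ℝ, 0 < lam₀ ∧ ∀ lam : ℝ, lam₀ ≤ lam → ∃ N₀ : ℕ, ∀ N : ℕ, N₀ ≤ N → let r : ℝ := lam * ((N + 1 : ℕ) : ℝ) ^ (-(1 / 3 : ℝ)); let γ := fun z (s : ℝ) => (Φ N).flow s z; let bx : UnitAddTorus (Fin 3) → UnitAddTorus (Fin 3) → ℝ := fun x y => 3 / (Real.pi * r ^ 3) * max (1 - Literature.Analysis.FluidPDE.Torus.euclidDist x y / r) 0; let ρm := fun z s (x₀ : UnitAddTorus (Fin 3)) => ∫ q, bx q.1 x₀ ∂(Literature.Analysis.FluidPDE.empiricalMeasure (γ z s)); let Θ := fun (Ξ : EuclideanSpace ℝ (Fin 3) × EuclideanSpace ℝ (Fin 3) × EuclideanSpace ℝ (Fin 3) → ℝ) (v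 w : EuclideanSpace ℝ (Fin 3)) => ∫ ω : Metric.sphere (0 : EuclideanSpace ℝ (Fin 3)) 1, Ξ ((ω : EuclideanSpace ℝ (Fin 3)), v, w) * Literature.MathematicalPhysics.KineticTheory.hardSphereKernel (w, v) ω ∂Literature.MathematicalPhysics.KineticTheory.sphereMeasure; let B := fun Ξ z s (x₀ : UnitAddTorus (Fin 3)) => ∫ p, bx p.1.1 x₀ * bx p.2.1 x₀ * Θ Ξ p.1.2 p.2.2 ∂((Literature.Analysis.FluidPDE.empiricalMeasure (γ z s)).prod (Literature.Analysis.FluidPDE.empiricalMeasure (γ z s))); Literature.MathematicalPhysics.KineticTheory.localGibbsLaw σ a₀ u₀ θ₀ N (Φ N) {z | η < σ ^ 3 * ((∫ s in Set.Icc (0 : ℝ) τ, ∫ x : UnitAddTorus (Fin 3), χ (s, x) * B Ξ z s x) - (∫ s in Set.Icc (0 : ℝ) τ, ∫ x : UnitAddTorus (Fin 3), χ (s, x) * gc (σ ^ 3 * ρm z s x) * B Ξ z s x))} ≤ ENNReal.ofReal δ := by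
  sorry

/-- **S3♭ · `stub_finiteEntropyDynamics` — REGULAR DYNAMICS FOR FINITE-ENTROPY STATES (Alexander ⊕ OVY §3).**  Every
translation-invariant probability law on unit-diameter hard-core configurations with finite intensity, finite kinetic-energy
density and FINITE ENTROPY DENSITY (relative to Poisson–Maxwell) is carried by configurations from which the infinite
hard-sphere dynamics exists as an a.e.-defined flow `Ψ` (Alexander's hypothesis structure `InfiniteHardSphereFlow (Fin 3) 1`)
with a.e. translation covariance.  (No stationarity here: `P` need not be invariant.  RESHAPED by lead c7 after the wave-1
audit: the planner's extra conjunct `∀ᵐ ω ∂P, HasFiniteClusters 1 ω (Ψ.traj ω)` (finite UNDIRECTED collision clusters on ALL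
windows) is dropped — stronger than Alexander's Prop 5.1 (finite causal chains), expected false on long windows by percolation of
the collision graph, consumed by no arrow of the composition; see `IsAdmissible`.  The audit also found the stub OPEN-grade rather
than "charted": Alexander's Thm 5.2 uses the Ruelle bound, Gaussian moments AND `T_r`-invariance of GIBBS states, his bad events are
only `r^{-c(log r)^δ}`-rare so the entropy inequality cannot transfer them, and non-equilibrium infinite dynamics in `d = 3` with
unbounded velocities is in print only for bounded smooth forces (Caglioti–Marchioro–Pulvirenti 2000); the entropy hypothesis is used
only through LOCAL ABSOLUTE CONTINUITY w.r.t. Poisson–Maxwell, which excludes the touching-chain data for which `binary` fails.)  Content: Alexander's regularity conditions (Def. 4.8 (b): polynomial growth of particle number and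
speeds in balls of radius `r`) hold `P`-a.s. — particle numbers by PACKING, speeds by the entropy inequality per window against
the Maxwellian reference (`P(∃ |v| > r^α in B_r) ≲ (h r³ + log 2)/r^{2α}`, Borel–Cantelli over dyadic `r`) — then Alexander's
deterministic construction `Tᵗ = lim T_rᵗ` (Thm 5.2, Prop 5.1) on the regular set, covariant by construction; finite clusters
from the same growth bounds (a chain reaching distance `R` within unit time needs speed `≳ R`).  This is the stub triage r1-1/r1-3
asked to isolate ("infinite dynamics for finite-entropy states, OVY §3 for hard spheres via Alexander, as its own L stub").
Why it might fail: Alexander's existence is vendored for GIBBS states only (`InfiniteHardSphereFlow.nonempty`, a named fact,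
not a theorem of the tree) and its deterministic half (regular solutions for regular configurations) is not in the tree at all —
the stub re-proves it (XL formalisation, charted); mathematically the only doubt is instantaneous momentum transfer along
touching chains (probability zero under finite entropy).  Leans on: `InfiniteHardSphereFlow` (structure), `IsInfiniteHardSphereTrajectory`,
`HasFiniteClusters`, `collisionCluster`, `IsHardCore.posLocallyFinite`, `HardSphereFlow`/`HardSphereEuclideanAlexander` (finite
flows as building blocks), `IsPoissonPointProcess` + `existsUnique_isPoissonPointProcess_holds`, `klDiv` entropy inequality
(`Literature.Probability.Divergences.toReal_measure_le_of_klDiv_le`); Alexander1976 §4.8, Prop 5.1, Thm 5.2, 5.3; OllaVaradhanYau1993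
§3 Lemmas 3.1–3.4 (p. 535). [size XL, open-grade (c7 audit)] -/
def Stubs.stub_finiteEntropyDynamics : Prop :=
  ∀ P : Measure PC, IsProbabilityMeasure P → IsTranslationInvariant P → (∀ᵐ ω ∂P, IsHardCore 1 ω) →
    intensity P < ⊤ → kineticEnergyDensity P < ⊤ → (∃ h : ℝ, HasEntropyDensityLE h P) →
    ∃ Ψ : InfiniteHardSphereFlow (Fin 3) 1, Ψ.IsAEDefined P ∧
      (∀ a : V3, ∀ᵐ ω ∂P, ∀ t : ℝ, Ψ.flow t (ω.translate (a, 0)) = (Ψ.flow t ω).translate (a, 0))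

/-- Registered stub S3♭ (`Stubs.stub_finiteEntropyDynamics`, verbatim): the `sorry` to be discharged. -/
theorem stub_finiteEntropyDynamics :
    ∀ P : Measure PC, IsProbabilityMeasure P → IsTranslationInvariant P → (∀ᵐ ω ∂P, IsHardCore 1 ω) →
      intensity P < ⊤ → kineticEnergyDensity P < ⊤ → (∃ h : ℝ, HasEntropyDensityLE h P) →
      ∃ Ψ : InfiniteHardSphereFlow (Fin 3) 1, Ψ.IsAEDefined P ∧
        (∀ a : V3, ∀ᵐ ω ∂P, ∀ t : ℝ, Ψ.flow t (ω.translate (a, 0)) = (Ψ.flow t ω).translate (a, 0)) := by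
  sorry

/-- **S3 · `stub_stationaryLimit` — OVY'S LOCAL ERGODIC LEMMA FOR HARD SPHERES (compactness + stationarity), stated GIVEN S3♭.**  For
`σ ∈ (0, ½]`, any hard-sphere flows `Φ_N`, `τ > 0`, a continuous weight `χ ≥ 0` positive somewhere on `[0,τ] × 𝕋³`, an
entropy budget `K`, a mass `δ > 0`, sizes `n k → ∞`, probability laws `μ k` on `(n k + 1)`-configurations with
`KL(μ k ‖ G_{n k}) ≤ K(n k + 1)` and events `E k` of `μ k`-mass `≥ δ`: along a subsequence the χ-weighted fdd local laws of the
systems restricted to `E k` (`fddLocalLaw`, normalised) converge (`IsFddLimit`) to an ADMISSIBLE state `(P, Ψ)`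
(`IsAdmissible`: TI probability law on unit-diameter hard-core configurations, `Ψ` an a.e.-defined STATIONARY infinite
hard-sphere flow with a.e. finite clusters and a.e. covariance, finite intensity / energy density, FINITE ENTROPY DENSITY).
Content: (i) tightness — positions by hard-core PACKING (no superstability needed), velocities by the entropy budget against
Maxwellian `G_N` (restriction to `E k` costs `≤ (K(n+1) + e⁻¹)/δ + log(1/δ)`: still extensive); (ii) translation invariance
from the `dx`-average, STATIONARITY from the macroscopic `ds`-average (a micro time shift `t` moves `s` by `ε_N t`: `χ`-modulus
+ `O(ε_N t/τ)` boundary mass); (iii) entropy density `≤ C(K, δ, χ)·σ³` by superadditivity over disjoint micro-windows (OVY Lemma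
3.x / 4.2); (iv) the dynamics: S3♭ supplies, for the one-time limit `P`, an a.e.-defined finite-cluster flow `Ψ` (a.e. UNIQUE by
finite clusters); the finite-`N` torus dynamics seen from `x` agrees locally, for large `N`, with it (uniform-in-`N` cluster /
fast-far-particle control by packing + entropy), giving the fdd convergence at rational lags (diagonal argument) and the
stationarity of `P` under `Ψ`.  Why it might fail: (iv) is printed only for smooth superstable potentials WITH noise used elsewhere (OVY) and
for Gibbs states (Alexander Thm 5.2); for hard spheres the influence of far fast particles / long collision chains within
micro-time `O(1)` under a mere entropy-density bound needs a hard-sphere replacement of OVY Lemma 3.2–3.4 (none in print; the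
tree vendors Alexander's existence for Gibbs states only).  Leans on: `localConfig`, `measurable_localConfig`, `localLaw(TimeAvg)`,
`InfiniteHardSphereFlow` (+ `.nonempty`/`.unique` as facts), `HasFiniteClusters`, `IsTranslationInvariant`, `intensity`,
`kineticEnergyDensity`, `PointConfig.localWeakTopology`/`tendsto_localWeak_iff`, `IsPoissonPointProcess` (+ existence),
`HardSphereFlow.measurable_flow_prod'`, `klDiv`; OllaVaradhanYau1993 §3, §4 Lemmas 4.1–4.3 (pp. 535–540); Alexander1976 Thm 5.2;
Spohn1991 I §2.2–2.4. [size XL, charted] -/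
def Stubs.stub_stationaryLimit : Prop :=
  Stubs.stub_finiteEntropyDynamics →
  ∀ σ : ℝ, 0 < σ → σ ≤ 1 / 2 →
  ∀ Φ : (N : ℕ) → HardSphereFlow (Torus.geometry (Fin 3)) (hsDiameter σ N) (N + 1),
  ∀ τ : ℝ, 0 < τ → ∀ χ : ℝ × T3 → ℝ, Continuous χ → (∀ p, 0 ≤ χ p) → (∃ s ∈ Set.Icc (0 : ℝ) τ, ∃ x : T3, 0 < χ (s, x)) →
  ∀ K δ : ℝ, 0 < δ → ∀ n : ℕ → ℕ, Tendsto n atTop atTop →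
  ∀ (μ : (k : ℕ) → Measure (Config (n k + 1) (Fin 3) T3)) (E : (k : ℕ) → Set (Config (n k + 1) (Fin 3) T3)),
    (∀ k, IsProbabilityMeasure (μ k)) →
    (∀ k, InformationTheory.klDiv (μ k)
        (localGibbsLaw σ (fun _ => (1 : ℝ)) (fun _ => (0 : V3)) (fun _ => (1 : ℝ)) (n k) (Φ (n k))) ≤
      ENNReal.ofReal (K * ((n k : ℝ) + 1))) →
    (∀ k, ENNReal.ofReal δ ≤ μ k (E k)) →
  ∃ φ : ℕ → ℕ, StrictMono φ ∧ ∃ (P : Measure PC) (Ψ : InfiniteHardSphereFlow (Fin 3) 1),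
    IsAdmissible P Ψ ∧ IsFddLimit σ Φ χ τ (fun k => n (φ k)) (fun k => μ (φ k)) (fun k => E (φ k)) P Ψ

/-- Registered stub S3 (`Stubs.stub_stationaryLimit`, verbatim): the `sorry` to be discharged. -/
theorem stub_stationaryLimit :
    Stubs.stub_finiteEntropyDynamics →
    ∀ σ : ℝ, 0 < σ → σ ≤ 1 / 2 →
    ∀ Φ : (N : ℕ) → HardSphereFlow (Torus.geometry (Fin 3)) (hsDiameter σ N) (N + 1),
    ∀ τ : ℝ, 0 < τ → ∀ χ : ℝ × T3 → ℝ, Continuous χ → (∀ p, 0 ≤ χ p) → (∃ s ∈ Set.Icc (0 : ℝ) τ, ∃ x : T3, 0 < χ (s, x)) →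
    ∀ K δ : ℝ, 0 < δ → ∀ n : ℕ → ℕ, Tendsto n atTop atTop →
    ∀ (μ : (k : ℕ) → Measure (Config (n k + 1) (Fin 3) T3)) (E : (k : ℕ) → Set (Config (n k + 1) (Fin 3) T3)),
      (∀ k, IsProbabilityMeasure (μ k)) →
      (∀ k, InformationTheory.klDiv (μ k)
          (localGibbsLaw σ (fun _ => (1 : ℝ)) (fun _ => (0 : V3)) (fun _ => (1 : ℝ)) (n k) (Φ (n k))) ≤
        ENNReal.ofReal (K * ((n k : ℝ) + 1))) →
      (∀ k, ENNReal.ofReal δ ≤ μ k (E k)) →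
    ∃ φ : ℕ → ℕ, StrictMono φ ∧ ∃ (P : Measure PC) (Ψ : InfiniteHardSphereFlow (Fin 3) 1),
      IsAdmissible P Ψ ∧ IsFddLimit σ Φ χ τ (fun k => n (φ k)) (fun k => μ (φ k)) (fun k => E (φ k)) P Ψ := by
  sorry

/-- **S4 · `stub_functionalLimits` — IDENTIFICATION: THE DEFICIT SURVIVES IN THE LIMIT STATE.**  Same data as S3 with
`E k :=` the cut kinetic deficit event (`cutDeficitEvent`, constant `g₀`, slack `η > 0`, scale `lam`): if `(P, Ψ)` is an
admissible fdd local limit of these deficit-restricted systems then `collisionRate Ψ P L 1 Ξ < g₀·idealRate P L gc Ξ < ∞`,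
`L = lam/σ`.  Content: (a) the EXACT finite-`N` dictionary `E[σ³∫∫χ gc B_{R_N}] = σ⁻³(∫χ)·E_{Q_N}[gc(localDensity_L)·pairFunctional_L]`
(unfold `localConfig`, `(N+1)ε_N³ = σ³`; `pairFunctional` is a LOCAL vaguely-continuous functional up to the velocity weight
`|v−w|`, made uniformly integrable by the entropy budget against Maxwellian `G_N`) ⇒ `E_{Q_N}[…] → idealRate` along the fdd (even
one-time) limit, and `idealRate < ∞` from packing + energy density; (b) `E[K_N[χΞ]] = σ⁻³(∫χ)·(rooted collision functional of the
χ-weighted local PATH law) + o(1)` (each collision at macro time `t` is charged to `s ∈ [t − ε_N, t)`, `χ`-modulus) and LOWER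
SEMICONTINUITY of the rooted collision intensity under fdd convergence to a finite-cluster hard-sphere state: slice micro-time,
a velocity change of a cube particle between consecutive slice times is an OPEN two-time event (Portmanteau), marks by
vague continuity of `Ξ ∘ (n̂, v⁻, w⁻)`, and a UNIFORM-in-`N` bound on double collisions of one particle within a short slice
(BBGKY/collision-cylinder estimate under packing + energy: `lintegral_collisionCylinder`); (c) on the restricted laws the deficit
holds surely: `E[K] ≤ g₀E[σ³∫∫χ gc B] − η·(mass)`, divide by `σ⁻³∫χ·mass` — the slack `η > 0` gives the STRICT inequality (and
forces `idealRate > 0`).  Why it might fail: the l.s.c. step (b) if fdd convergence were too weak to see collisions of the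
limit flow — it is not for finite-cluster limits, but the uniform double-collision estimate along NON-equilibrium entropy-class
flows is the one non-soft input (a failure would itself be a burst phenomenon à la S7a of the dead line).  Leans on:
`integral_empiricalCollisionMeasure_eq_finsum_ite`, `HardSphereFlow.empiricalCollisionMeasure`, `lintegral_collisionCylinder`,
`HardSphereCollisionIntensity(Density)`, `palmLaw`/`lintegral_palmLaw` (Campbell), `succ_mul_hsDiameter_pow_three`,
`PointConfig.tendsto_localWeak_iff`, `IsInfiniteHardSphereTrajectory` (fields `binary`, `locFinite`); OllaVaradhanYau1993 §4
(4.13)–(4.16); Spohn1991 I (3.x) collision cylinders; Geman–Horowitz (Palm measures of flows). [size L] -/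
def Stubs.stub_functionalLimits : Prop :=
  ∀ σ : ℝ, 0 < σ → σ ≤ 1 / 2 →
  ∀ Φ : (N : ℕ) → HardSphereFlow (Torus.geometry (Fin 3)) (hsDiameter σ N) (N + 1),
  ∀ τ : ℝ, 0 < τ → ∀ χ : ℝ × T3 → ℝ, Continuous χ → (∀ p, 0 ≤ χ p) →
  ∀ Ξ : V3 × V3 × V3 → ℝ, Continuous Ξ → (∀ q, 0 ≤ Ξ q) → (∃ C : ℝ, ∀ q, Ξ q ≤ C) →
  ∀ gc : ℝ → ℝ, Continuous gc → (∀ a, 0 ≤ gc a) → (∀ a, gc a ≤ 1) →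
  ∀ K g₀ η lam δ : ℝ, 0 < g₀ → 0 < η → 0 < lam → 0 < δ →
  ∀ n : ℕ → ℕ, Tendsto n atTop atTop →
  ∀ μ : (k : ℕ) → Measure (Config (n k + 1) (Fin 3) T3),
    (∀ k, IsProbabilityMeasure (μ k)) →
    (∀ k, InformationTheory.klDiv (μ k)
        (localGibbsLaw σ (fun _ => (1 : ℝ)) (fun _ => (0 : V3)) (fun _ => (1 : ℝ)) (n k) (Φ (n k))) ≤
      ENNReal.ofReal (K * ((n k : ℝ) + 1))) →
    (∀ k, ENNReal.ofReal δ ≤ μ k (cutDeficitEvent σ (n k) (Φ (n k)) τ χ gc Ξ g₀ η lam)) →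
  ∀ (P : Measure PC) (Ψ : InfiniteHardSphereFlow (Fin 3) 1), IsAdmissible P Ψ →
    IsFddLimit σ Φ χ τ n μ (fun k => cutDeficitEvent σ (n k) (Φ (n k)) τ χ gc Ξ g₀ η lam) P Ψ →
    collisionRate Ψ P (lam / σ) (fun _ => (1 : ℝ)) Ξ < ENNReal.ofReal g₀ * idealRate P (lam / σ) gc Ξ ∧
      idealRate P (lam / σ) gc Ξ < ⊤

/-- Registered stub S4 (`Stubs.stub_functionalLimits`, verbatim): the `sorry` to be discharged. -/
theorem stub_functionalLimits :
    ∀ σ : ℝ, 0 < σ → σ ≤ 1 / 2 →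
    ∀ Φ : (N : ℕ) → HardSphereFlow (Torus.geometry (Fin 3)) (hsDiameter σ N) (N + 1),
    ∀ τ : ℝ, 0 < τ → ∀ χ : ℝ × T3 → ℝ, Continuous χ → (∀ p, 0 ≤ χ p) →
    ∀ Ξ : V3 × V3 × V3 → ℝ, Continuous Ξ → (∀ q, 0 ≤ Ξ q) → (∃ C : ℝ, ∀ q, Ξ q ≤ C) →
    ∀ gc : ℝ → ℝ, Continuous gc → (∀ a, 0 ≤ gc a) → (∀ a, gc a ≤ 1) →
    ∀ K g₀ η lam δ : ℝ, 0 < g₀ → 0 < η → 0 < lam → 0 < δ →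
    ∀ n : ℕ → ℕ, Tendsto n atTop atTop →
    ∀ μ : (k : ℕ) → Measure (Config (n k + 1) (Fin 3) T3),
      (∀ k, IsProbabilityMeasure (μ k)) →
      (∀ k, InformationTheory.klDiv (μ k)
          (localGibbsLaw σ (fun _ => (1 : ℝ)) (fun _ => (0 : V3)) (fun _ => (1 : ℝ)) (n k) (Φ (n k))) ≤
        ENNReal.ofReal (K * ((n k : ℝ) + 1))) →
      (∀ k, ENNReal.ofReal δ ≤ μ k (cutDeficitEvent σ (n k) (Φ (n k)) τ χ gc Ξ g₀ η lam)) →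
    ∀ (P : Measure PC) (Ψ : InfiniteHardSphereFlow (Fin 3) 1), IsAdmissible P Ψ →
      IsFddLimit σ Φ χ τ n μ (fun k => cutDeficitEvent σ (n k) (Φ (n k)) τ χ gc Ξ g₀ η lam) P Ψ →
      collisionRate Ψ P (lam / σ) (fun _ => (1 : ℝ)) Ξ < ENNReal.ofReal g₀ * idealRate P (lam / σ) gc Ξ ∧
        idealRate P (lam / σ) gc Ξ < ⊤ := by
  sorry

/-- **S5 · `stub_noScreening` — STATIONARY NO-SCREENING (THE LINE'S BET; hardest).**  There are a diluteness threshold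
`η₀ > 0`, a constant `g⋆ > 0` and a scale `L₀` such that for every `L ≥ L₀`, every ADMISSIBLE state `(P, Ψ)` — whatever its
entropy density — every bounded continuous mark `Ξ ≥ 0` and every continuous cutoff `0 ≤ gc ≤ 1` vanishing on `[η₀, ∞)`:
`g⋆ · idealRate P L gc Ξ ≤ collisionRate Ψ P L gc Ξ` — no dilute stationary finite-entropy state of the infinite hard-sphere
gas SCREENS collisions below a uniform multiple of the (cut, kinetic-scale) ideal rate.  A ONE-SIDED, KINEMATIC shadow of the
Boltzmann hypothesis: the classification "stationary + TI + finite entropy ⇒ Gibbs mixture" (BoltzmannHypothesisBarrier: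
needed-but-unavailable) would give it with `g⋆ = ½` (Enskog `Y ≥ 1`), but far less is asked — a floor on ONE Palm intensity,
linear in `P` (so mixtures need no ergodic decomposition: no cross terms at the kinetic scale, unlike the `r`-scale product of
averages now isolated in S1), with the explicit non-Gibbs stationary examples on the right side (ideal gas: vacuous; hard rods:
rate = ideal/(1−ρa) ≥ ideal) and the exact screeners (combed / laned states, collision-free) excluded by FINITE ENTROPY DENSITY.
Mechanism (card): in a stationary state the aimed-pair intensity at separation `R ∈ (1, ℓ/C)` is fed by free transport plus
third-body gain (stationary BBGKY-2 on `{|q| > 1}`, gain `≥ 0` kept one flight deep — no expansion); exact screening forces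
persistently empty aimed tubes, i.e. velocities enslaved to positions (singular); finite entropy gives transverse relative-velocity
spread on a positive density of pairs, one isotropic deflection + free flight over a mean free path FLATTENS impact parameters
(cap-ratio kernel `(ε/R)²`, `b = cos(χ/2)`, ChapmanCowling1970 §5.1), and the cut confines everything to packing `< η₀` where
knock-out over one flight is `O(η₀)`.  Why it might fail: (1) a translation-invariant, stationary, finite-entropy-density,
dilute state that screens an open set of marks (none known; near-combed smoothings are not stationary; drift/temperature
mixtures do not screen); (2) the constant: `g⋆` or `L₀` secretly depending on the entropy density `h` (triage r1-1/r1-3: then the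
bridge, whose `h ≍ (K + 1)/δ`, yields only the FLAT order `∀profiles ∀δ ∃g₀` = c4's `RateFloorFlat`, a strict weakening) — the
uniformity is the load-bearing bet, consistent with the conjectured h-free classification.  Leans on: `palmLaw`, `IsPointStationary`,
`lintegral_palmLaw`, `PalmUniqueness` (fact), `lintegral_collisionCylinder`, `IsInfiniteHardSphereTrajectory`, `HasFiniteClusters`,
`hardSphereKernel_swap_pos_iff` (Disproof §1), Mathlib ergodic decomposition; OllaVaradhanYau1993 §1 p. 525 (what is NOT
claimed), Gurevich–Suhov CMP 49/54/84 (stationary BBGKY ⇒ Gibbs under smoothness), Spohn1991 I §2.4 p. 25 (non-Gibbs stationary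
states: ideal gas, hard rods), ChapmanCowling1970 §5.1, §16.21, Alexander1976. [size XL, open; the crux-grade leaf] -/
def Stubs.stub_noScreening : Prop :=
  ∃ η₀ : ℝ, 0 < η₀ ∧ ∃ gStar : ℝ, 0 < gStar ∧ ∃ L₀ : ℝ, 0 < L₀ ∧ ∀ L : ℝ, L₀ ≤ L →
    ∀ (P : Measure PC) (Ψ : InfiniteHardSphereFlow (Fin 3) 1), IsAdmissible P Ψ →
    ∀ Ξ : V3 × V3 × V3 → ℝ, Continuous Ξ → (∀ q, 0 ≤ Ξ q) → (∃ C : ℝ, ∀ q, Ξ q ≤ C) →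
    ∀ gc : ℝ → ℝ, Continuous gc → (∀ a, 0 ≤ gc a) → (∀ a, gc a ≤ 1) → (∀ a, η₀ ≤ a → gc a = 0) →
      ENNReal.ofReal gStar * idealRate P L gc Ξ ≤ collisionRate Ψ P L gc Ξ

/-- Registered stub S5 (`Stubs.stub_noScreening`, verbatim): the `sorry` to be discharged. -/
theorem stub_noScreening :
    ∃ η₀ : ℝ, 0 < η₀ ∧ ∃ gStar : ℝ, 0 < gStar ∧ ∃ L₀ : ℝ, 0 < L₀ ∧ ∀ L : ℝ, L₀ ≤ L →
      ∀ (P : Measure PC) (Ψ : InfiniteHardSphereFlow (Fin 3) 1), IsAdmissible P Ψ →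
      ∀ Ξ : V3 × V3 × V3 → ℝ, Continuous Ξ → (∀ q, 0 ≤ Ξ q) → (∃ C : ℝ, ∀ q, Ξ q ≤ C) →
      ∀ gc : ℝ → ℝ, Continuous gc → (∀ a, 0 ≤ gc a) → (∀ a, gc a ≤ 1) → (∀ a, η₀ ≤ a → gc a = 0) →
        ENNReal.ofReal gStar * idealRate P L gc Ξ ≤ collisionRate Ψ P L gc Ξ := by
  sorry

/-! ## §4 Composition, step 1: the entropy-class cut kinetic floor from S3♭ + S3 + S4 + S5 (contradiction + countable choice) -/

/-- The collision intensity is monotone in the cut: `gc ≤ 1` and `Ξ ≥ 0` give `collisionRate … gc Ξ ≤ collisionRate … 1 Ξ`. [folklore] -/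
theorem collisionRate_mono_cut (Ψ : InfiniteHardSphereFlow (Fin 3) 1) (P : Measure PC) (L : ℝ) {gc : ℝ → ℝ}
    (hgc1 : ∀ a, gc a ≤ 1) {Ξ : V3 × V3 × V3 → ℝ} (hΞ0 : ∀ q, 0 ≤ Ξ q) :
    collisionRate Ψ P L gc Ξ ≤ collisionRate Ψ P L (fun _ => (1 : ℝ)) Ξ := by
  unfold collisionRate
  refine lintegral_mono fun ω => ENNReal.tsum_le_tsum fun e => ENNReal.ofReal_le_ofReal ?_
  unfold collisionMark
  exact mul_le_mul_of_nonneg_right (hgc1 _) (hΞ0 _)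

/-- The crux's collision functional is nonnegative for nonnegative integrands (Disproof §2 `Kc_nonneg`, re-proved). [folklore] -/
theorem Kc_nonneg' {N : ℕ} (S : Set ℝ) {c : ℝ} (hc : 0 ≤ c) (Pr : ℝ → Fin N → Fin N → Prop)
    [∀ s i j, Decidable (Pr s i j)] (F : ℝ → Fin N → Fin N → ℝ) (hF : ∀ s i j, 0 ≤ F s i j) :
    0 ≤ c * ∑ᶠ (s : ℝ) (_ : s ∈ S), ∑ i, ∑ j, (if Pr s i j then F s i j else 0) :=
  mul_nonneg hc (finsum_nonneg fun s => finsum_nonneg fun _ =>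
    Finset.sum_nonneg fun i _ => Finset.sum_nonneg fun j _ => by
      split_ifs
      · exact hF s i j
      · exact le_rfl)

/-- If `χ` vanishes on `[0,τ] × 𝕋³` the cut deficit event is EMPTY (`K ≥ 0`, the ideal side is `0`, and `η > 0` — this is
exactly where `0 < η` is load-bearing, cf. `Negative/WithoutEtaPos`). [folklore] -/
theorem cutDeficitEvent_eq_empty_of_chi_zero {σ : ℝ} (hσ : 0 < σ) {N : ℕ}
    (Φ : HardSphereFlow (Torus.geometry (Fin 3)) (hsDiameter σ N) (N + 1)) {τ : ℝ} {χ : ℝ × T3 → ℝ}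
    (hχ : ∀ s ∈ Set.Icc (0 : ℝ) τ, ∀ x : T3, χ (s, x) = 0) (hχ0 : ∀ p, 0 ≤ χ p) (gc : ℝ → ℝ)
    {Ξ : V3 × V3 × V3 → ℝ} (hΞ0 : ∀ q, 0 ≤ Ξ q) (g₀ : ℝ) {η : ℝ} (hη : 0 < η) (lam : ℝ) :
    cutDeficitEvent σ N Φ τ χ gc Ξ g₀ η lam = ∅ := by
  ext z
  simp only [Set.mem_empty_iff_false, iff_false]
  intro hz
  dsimp only [cutDeficitEvent, Set.mem_setOf_eq] at hz
  have hI : ∀ (G H : ℝ → UnitAddTorus (Fin 3) → ℝ),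
      (∫ s in Set.Icc (0 : ℝ) τ, ∫ x : UnitAddTorus (Fin 3), χ (s, x) * G s x * H s x) = 0 := fun G H =>
    setIntegral_eq_zero_of_forall_eq_zero fun s hs => by simp only [hχ s hs, zero_mul, integral_zero]
  rw [hI, mul_zero, zero_sub] at hz
  have key : ∀ {Kv : ℝ}, 0 ≤ Kv → ¬ Kv < -η := fun hKv h => by linarith
  refine key ?_ hz
  refine mul_nonneg (div_nonneg (hsDiameter_pos hσ N).le (by positivity)) (finsum_nonneg fun s =>
    finsum_nonneg fun _ => Finset.sum_nonneg fun i _ => Finset.sum_nonneg fun j _ => ?_)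
  split_ifs
  · exact mul_nonneg (hχ0 _) (hΞ0 _)
  · exact le_rfl

/-- **The entropy-class cut kinetic floor from S3♭ + S3 + S4 + S5** (PROVED).  Take `η₀, g⋆, L₀` from S5, `g₀ := g⋆`, `σ₀ := ½`,
`lam₀ := L₀σ`.  If for some `lam ≥ lam₀` no `N₀` works, countable choice gives sizes `n k ≥ k` and entropy-class laws `μ k` charging
the deficit event with mass `> δ`; S3 extracts an admissible fdd limit `(P, Ψ)` along a subsequence, S4 gives
`collisionRate(1·Ξ) < g⋆·idealRate(gc·Ξ)`, S5 at `L = lam/σ ≥ L₀` gives `g⋆·idealRate ≤ collisionRate(gc·Ξ) ≤ collisionRate(1·Ξ)`: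
contradiction.  (If `χ ≡ 0` on the slab the event is empty — the `η > 0` branch.) [folklore] -/
theorem entropyClassCutRateFloorKinetic_of_stationary (h3b : Stubs.stub_finiteEntropyDynamics)
    (h3 : Stubs.stub_stationaryLimit) (h4 : Stubs.stub_functionalLimits) (h5 : Stubs.stub_noScreening) :
    ∃ η₀ : ℝ, 0 < η₀ ∧ ∃ g₀ : ℝ, 0 < g₀ ∧ EntropyClassCutRateFloorKinetic η₀ g₀ := by
  obtain ⟨η₀, hη₀, gS, hgS, L₀, hL₀, h5⟩ := h5
  refine ⟨η₀, hη₀, gS, hgS, 1 / 2, by norm_num, ?_⟩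
  intro σ hσ hσlt Φ τ hτ χ hχc hχ0 Ξ hΞc hΞ0 hΞC gc hgc hgc0 hgc1 hgcη K η δ hη hδ
  have hσ2 : σ ≤ 1 / 2 := hσlt.le
  refine ⟨L₀ * σ, by positivity, fun lam hlam => ?_⟩
  have hlam0 : 0 < lam := lt_of_lt_of_le (by positivity) hlam
  have hL : L₀ ≤ lam / σ := by rwa [le_div_iff₀ hσ]
  by_contra hcon
  push Not at hcon
  by_cases hχpos : ∃ s ∈ Set.Icc (0 : ℝ) τ, ∃ x : T3, 0 < χ (s, x)
  · choose n hn μ hμP hμK hμD using hcon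
    have hn' : Tendsto n atTop atTop := tendsto_atTop_mono hn tendsto_id
    obtain ⟨φ, hφ, P, Ψ, hadm, hlim⟩ := h3 h3b σ hσ hσ2 Φ τ hτ χ hχc hχ0 hχpos K δ hδ n hn' μ
      (fun k => cutDeficitEvent σ (n k) (Φ (n k)) τ χ gc Ξ gS η lam) hμP hμK (fun k => (hμD k).le)
    obtain ⟨hlt, -⟩ := h4 σ hσ hσ2 Φ τ hτ χ hχc hχ0 Ξ hΞc hΞ0 hΞC gc hgc hgc0 hgc1 K gS η lam δ hgS hη hlam0 hδ
      (fun k => n (φ k)) (hn'.comp hφ.tendsto_atTop) (fun k => μ (φ k)) (fun k => hμP (φ k)) (fun k => hμK (φ k))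
      (fun k => (hμD (φ k)).le) P Ψ hadm hlim
    have hfloor := h5 (lam / σ) hL P Ψ hadm Ξ hΞc hΞ0 hΞC gc hgc hgc0 hgc1 hgcη
    have hmono := collisionRate_mono_cut Ψ P (lam / σ) hgc1 hΞ0
    exact lt_irrefl _ ((hfloor.trans hmono).trans_lt hlt)
  · push Not at hχpos
    have hχz : ∀ s ∈ Set.Icc (0 : ℝ) τ, ∀ x : T3, χ (s, x) = 0 := fun s hs x => le_antisymm (hχpos s hs x) (hχ0 _)
    obtain ⟨N, -, μ, -, -, hμD⟩ := hcon 0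
    rw [cutDeficitEvent_eq_empty_of_chi_zero hσ (Φ N) hχz hχ0 gc hΞ0 gS hη lam, measure_empty] at hμD
    exact absurd hμD ENNReal.not_lt_zero

/-! ## §5 Composition, step 2: local-Gibbs data are in the entropy class (tree: `exists_localGibbsLaw_dominated`) -/

/-- **`CutRateFloorKinetic` from `EntropyClassCutRateFloorKinetic`** (PROVED; the pattern of c4's
`rateFloor_of_entropyClassRateFloor`, p125013): a continuous local Gibbs datum has relative entropy `≤ A(profiles, σ)(N+1)` with
respect to `G_N` (`exists_localGibbsLaw_dominated`), so it is in the class with `K := A`; `σ₀ := min σ₀ ½`. [cite: KipnisLandim1999, Ch. 6 §1] -/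
theorem cutRateFloorKinetic_of_entropyClass {η₀ g₀ : ℝ} (h : EntropyClassCutRateFloorKinetic η₀ g₀) :
    CutRateFloorKinetic η₀ g₀ := by
  obtain ⟨σ₁, hσ₁, h⟩ := h
  intro a₀ θ₀ u₀ ha hθ hu ha0 hθ0
  refine ⟨min σ₁ 2⁻¹, lt_min hσ₁ (by norm_num), ?_⟩
  intro σ hσ hσlt Φ τ hτ χ hχc hχ0 Ξ hΞc hΞ0 hΞC gc hgc hgc0 hgc1 hgcη η δ hη hδ
  have hσ₁' : σ < σ₁ := hσlt.trans_le (min_le_left _ _)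
  have hσ2 : σ ≤ 1 / 2 := by
    have := hσlt.trans_le (min_le_right σ₁ 2⁻¹)
    rw [one_div]; exact this.le
  obtain ⟨A, b, hA, hb, hdom⟩ :=
    Summit.AtomisticToContinuum.HydrodynamicLimit.Theorems.LambertianContactSwapSwapGapGibbsDomination.exists_localGibbsLaw_dominated
      ha hθ hu ha0 hθ0 hσ2
  obtain ⟨lam₀, hlam₀, h⟩ := h σ hσ hσ₁' Φ τ hτ χ hχc hχ0 Ξ hΞc hΞ0 hΞC gc hgc hgc0 hgc1 hgcη A η δ hη hδ
  refine ⟨lam₀, hlam₀, fun lam hlam => ?_⟩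
  obtain ⟨N₀, hN⟩ := h lam hlam
  refine ⟨N₀, fun N hNN => ?_⟩
  have hP : IsProbabilityMeasure (localGibbsLaw σ a₀ u₀ θ₀ N (Φ N)) :=
    isProbabilityMeasure_localGibbsLaw ha hθ hu ha0 hθ0 hσ2 N (Φ N)
  obtain ⟨-, -, hKL, -, -⟩ := hdom N (Φ N)
  exact hN N hNN (localGibbsLaw σ a₀ u₀ θ₀ N (Φ N)) hP hKL

/-! ## §6 Composition, step 3: removing the cut with the dense complement S2 (union bound, pure arithmetic) -/

/-- Union-bound arithmetic of the cut removal: if the cut deficit `K < g₀ s I_g − η₁` and the dense excess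
`η₂ < s (I − I_g)` are both rare, so is the uncut deficit `K < g₀ s I − η` once `η₁ + g₀η₂ ≤ η`. [folklore] -/
theorem measure_uncut_le_add {α : Type*} [MeasurableSpace α] (μ : Measure α) (Kf Ir Ig : α → ℝ)
    {g₀ s η η₁ η₂ : ℝ} (hg₀ : 0 ≤ g₀) (hη : η₁ + g₀ * η₂ ≤ η) {a b : ℝ≥0∞}
    (h1 : μ {z | Kf z < g₀ * s * Ig z - η₁} ≤ a) (h2 : μ {z | η₂ < s * (Ir z - Ig z)} ≤ b) :
    μ {z | Kf z < g₀ * s * Ir z - η} ≤ a + b := by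
  have hsub : {z | Kf z < g₀ * s * Ir z - η} ⊆ {z | Kf z < g₀ * s * Ig z - η₁} ∪ {z | η₂ < s * (Ir z - Ig z)} := by
    intro z hz
    by_contra hcon
    simp only [Set.mem_union, Set.mem_setOf_eq, not_or, not_lt] at hcon
    obtain ⟨hK, hI⟩ := hcon
    have hz' : Kf z < g₀ * s * Ir z - η := hz
    have h3 : g₀ * (s * (Ir z - Ig z)) ≤ g₀ * η₂ := mul_le_mul_of_nonneg_left hI hg₀
    have h4 : g₀ * (s * (Ir z - Ig z)) = g₀ * s * Ir z - g₀ * s * Ig z := by ring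
    linarith
  calc μ {z | Kf z < g₀ * s * Ir z - η}
      ≤ μ ({z | Kf z < g₀ * s * Ig z - η₁} ∪ {z | η₂ < s * (Ir z - Ig z)}) := measure_mono hsub
    _ ≤ μ {z | Kf z < g₀ * s * Ig z - η₁} + μ {z | η₂ < s * (Ir z - Ig z)} := measure_union_le _ _
    _ ≤ a + b := add_le_add h1 h2

/-- The standard cutoff `gc₀(a) = max 0 (min 1 (2 − 2a/η₀))`: continuous, `[0,1]`-valued, `= 1` on `[0, η₀/2]`, `= 0` on `[η₀, ∞)`. [folklore] -/
theorem stdCutoff_props {η₀ : ℝ} (hη₀ : 0 < η₀) :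
    Continuous (fun a : ℝ => max 0 (min 1 (2 - 2 * a / η₀))) ∧
    (∀ a : ℝ, 0 ≤ max 0 (min 1 (2 - 2 * a / η₀))) ∧ (∀ a : ℝ, max 0 (min 1 (2 - 2 * a / η₀)) ≤ 1) ∧
    (∀ a : ℝ, η₀ ≤ a → max 0 (min 1 (2 - 2 * a / η₀)) = 0) ∧
    (∀ a : ℝ, a ≤ η₀ / 2 → max 0 (min 1 (2 - 2 * a / η₀)) = 1) := by
  refine ⟨?_, fun a => le_max_left _ _, fun a => max_le zero_le_one (min_le_left _ _), fun a ha => ?_, fun a ha => ?_⟩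
  · exact continuous_const.max (continuous_const.min (continuous_const.sub
      ((continuous_const.mul continuous_id).div_const η₀)))
  · have h1 : 2 - 2 * a / η₀ ≤ 0 := by
      have : 2 ≤ 2 * a / η₀ := by rw [le_div_iff₀ hη₀]; linarith
      linarith
    exact max_eq_left ((min_le_right _ _).trans h1)
  · have h1 : 1 ≤ 2 - 2 * a / η₀ := by
      have : 2 * a / η₀ ≤ 1 := by rw [div_le_iff₀ hη₀]; linarith
      linarith
    rw [min_eq_left h1, max_eq_right zero_le_one]

/-- **`RateFloorKinetic` from the cut floor and the dense complement** (PROVED): `σ₀ := min`, cutoff `gc₀`, slacks `η/2` (cut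
floor) and `η/(2g₀)` (dense excess), confidences `δ/2`, `lam₀ := max`, `N₀ := max`; then `measure_uncut_le_add` after
ζ-reducing the three `let`-chains (they are the crux's, verbatim). [folklore] -/
theorem rateFloorKinetic_of_cut_of_dense {η₀ g₀ : ℝ} (hg₀ : 0 < g₀) (hη₀ : 0 < η₀) (hcut : CutRateFloorKinetic η₀ g₀)
    (hdense : Stubs.stub_denseComplementKinetic) : RateFloorKinetic := by
  obtain ⟨hgc, hgc0, hgc1, hgcη, hgc_one⟩ := stdCutoff_props hη₀
  set gc : ℝ → ℝ := fun a => max 0 (min 1 (2 - 2 * a / η₀)) with hgcdef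
  refine ⟨g₀, hg₀, fun a₀ θ₀ u₀ ha hθ hu ha0 hθ0 => ?_⟩
  obtain ⟨σa, hσa, hcut⟩ := hcut a₀ θ₀ u₀ ha hθ hu ha0 hθ0
  obtain ⟨σb, hσb, hdense⟩ := hdense η₀ hη₀ a₀ θ₀ u₀ ha hθ hu ha0 hθ0
  refine ⟨min σa σb, lt_min hσa hσb, ?_⟩
  intro σ hσ hσlt Φ τ hτ χ hχc hχ0 Ξ hΞc hΞ0 hΞC η δ hη hδ
  have hσa' : σ < σa := hσlt.trans_le (min_le_left _ _)
  have hσb' : σ < σb := hσlt.trans_le (min_le_right _ _)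
  have hsplit : η / 2 + g₀ * (η / (2 * g₀)) ≤ η := by
    have : g₀ * (η / (2 * g₀)) = η / 2 := by field_simp
    linarith
  obtain ⟨lam₁, hlam₁, hcut⟩ := hcut σ hσ hσa' Φ τ hτ χ hχc hχ0 Ξ hΞc hΞ0 hΞC gc hgc hgc0 hgc1 hgcη (η / 2) (δ / 2)
    (by positivity) (by positivity)
  obtain ⟨lam₂, hlam₂, hdense⟩ := hdense σ hσ hσb' Φ τ hτ χ hχc hχ0 Ξ hΞc hΞ0 hΞC gc hgc hgc0 hgc1 hgc_one
    (η / (2 * g₀)) (δ / 2) (by positivity) (by positivity)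
  refine ⟨max lam₁ lam₂, lt_max_of_lt_left hlam₁, fun lam hlam => ?_⟩
  obtain ⟨Na, hcut⟩ := hcut lam ((le_max_left _ _).trans hlam)
  obtain ⟨Nb, hdense⟩ := hdense lam ((le_max_right _ _).trans hlam)
  refine ⟨max Na Nb, fun N hN => ?_⟩
  have e1 := hcut N ((le_max_left _ _).trans hN)
  have e2 := hdense N ((le_max_right _ _).trans hN)
  dsimp only [cutDeficitEvent] at e1
  dsimp only at e2 ⊢
  have h := measure_uncut_le_add (Literature.MathematicalPhysics.KineticTheory.localGibbsLaw σ a₀ u₀ θ₀ N (Φ N)) _ _ _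
    hg₀.le hsplit e1 e2
  refine h.trans ?_
  rw [← ENNReal.ofReal_add (by positivity) (by positivity), add_halves]

/-! ## §7 Composition, step 4: THE SPLIT `RateFloorKinetic → SubgridDomination → RateFloor` (lead c4, `Lines/SketchSplit.lean`, copied verbatim) -/

/-- The union-bound arithmetic of the split, abstractly (c4): if the kinetic deficit `K < gᵏ s Iᵏ − η₁` and the domination failure
`Cd Iᵏ + η₂ < I` are both rare, so is the macroscopic deficit `K < (gᵏ/Cd) s I − η` once `η₁ + (gᵏ/Cd) s η₂ ≤ η`. [folklore] -/
theorem measure_deficit_le_add {α : Type*} [MeasurableSpace α] (μ : Measure α) (Kf Ir Ik : α → ℝ)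
    {gk Cd s η η₁ η₂ : ℝ} (hgk : 0 ≤ gk) (hCd : 0 < Cd) (hs : 0 ≤ s) (hη : η₁ + gk / Cd * s * η₂ ≤ η) {a b : ℝ≥0∞}
    (h1 : μ {z | Kf z < gk * s * Ik z - η₁} ≤ a) (h2 : μ {z | Cd * Ik z + η₂ < Ir z} ≤ b) :
    μ {z | Kf z < gk / Cd * s * Ir z - η} ≤ a + b := by
  -- adapted from Lines/SketchSplit.lean (prover-line-stmt-AtomisticToContinuum-13080-c4-0)
  have hsub : {z | Kf z < gk / Cd * s * Ir z - η} ⊆ {z | Kf z < gk * s * Ik z - η₁} ∪ {z | Cd * Ik z + η₂ < Ir z} := by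
    intro z hz
    by_contra hcon
    simp only [Set.mem_union, Set.mem_setOf_eq, not_or, not_lt] at hcon
    obtain ⟨hK, hI⟩ := hcon
    have hz' : Kf z < gk / Cd * s * Ir z - η := hz
    have hc : 0 ≤ gk / Cd * s := by positivity
    have h3 : gk / Cd * s * Ir z ≤ gk / Cd * s * (Cd * Ik z + η₂) := mul_le_mul_of_nonneg_left hI hc
    have h4 : gk / Cd * s * (Cd * Ik z + η₂) = gk * s * Ik z + gk / Cd * s * η₂ := by
      field_simp
    nlinarith
  calc μ {z | Kf z < gk / Cd * s * Ir z - η} ≤ μ ({z | Kf z < gk * s * Ik z - η₁} ∪ {z | Cd * Ik z + η₂ < Ir z}) :=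
        measure_mono hsub
    _ ≤ μ {z | Kf z < gk * s * Ik z - η₁} + μ {z | Cd * Ik z + η₂ < Ir z} := measure_union_le _ _
    _ ≤ a + b := add_le_add h1 h2

/-- Reducible alias of the crux, used ONLY as the result type of the copied split lemma below so that the skeleton audit sees exactly
one theorem (`RateFloor_of`) concluding `RateFloor` by name; it is not a stub and nothing is registered against it. [folklore] -/
abbrev SplitTarget : Prop := RateFloor

/-- **THE SPLIT: `RateFloorKinetic → SubgridDomination → RateFloor`** (c4, PROVED; copied).  With `g₀ := g₀ᵏ/Cd`. [folklore] -/
theorem rateFloor_of_kinetic_of_subgrid (hkin : RateFloorKinetic) (hsub : Stubs.stub_subgridDomination) : SplitTarget := by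
  show RateFloor
  -- adapted from Lines/SketchSplit.lean (prover-line-stmt-AtomisticToContinuum-13080-c4-0)
  obtain ⟨gk, hgk, hkin⟩ := hkin
  obtain ⟨Cd, hCd, hsub⟩ := hsub
  refine ⟨gk / Cd, by positivity, fun a₀ θ₀ u₀ ha hθ hu ha0 hθ0 => ?_⟩
  obtain ⟨σa, hσa, hkin⟩ := hkin a₀ θ₀ u₀ ha hθ hu ha0 hθ0
  obtain ⟨σb, hσb, hsub⟩ := hsub a₀ θ₀ u₀ ha hθ hu ha0 hθ0
  refine ⟨min σa σb, lt_min hσa hσb, ?_⟩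
  intro σ hσ hσlt Φ τ hτ χ hχc hχ0 Ξ hΞc hΞ0 hΞC η δ hη hδ
  have hσa' : σ < σa := hσlt.trans_le (min_le_left _ _)
  have hσb' : σ < σb := hσlt.trans_le (min_le_right _ _)
  have hs : (0 : ℝ) ≤ σ ^ 3 := by positivity
  set η₂ : ℝ := η / (2 * (gk / Cd * σ ^ 3 + 1)) with hη₂
  have hη₂pos : 0 < η₂ := by positivity
  have hsplit : η / 2 + gk / Cd * σ ^ 3 * η₂ ≤ η := by
    have hc : 0 ≤ gk / Cd * σ ^ 3 := by positivity
    have h1 : gk / Cd * σ ^ 3 * η₂ ≤ η / 2 := by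
      rw [hη₂]
      rw [show gk / Cd * σ ^ 3 * (η / (2 * (gk / Cd * σ ^ 3 + 1))) = η / 2 * (gk / Cd * σ ^ 3 / (gk / Cd * σ ^ 3 + 1)) by
        field_simp]
      have h2 : gk / Cd * σ ^ 3 / (gk / Cd * σ ^ 3 + 1) ≤ 1 := (div_le_one (by positivity)).2 (by linarith)
      exact mul_le_of_le_one_right (by positivity) h2
    linarith
  obtain ⟨lam₀, hlam₀, hkin⟩ := hkin σ hσ hσa' Φ τ hτ χ hχc hχ0 Ξ hΞc hΞ0 hΞC (η / 2) (δ / 2) (by positivity) (by positivity)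
  obtain ⟨r₀, hr₀, hsub⟩ := hsub σ hσ hσb' Φ τ hτ χ hχc hχ0 Ξ hΞc hΞ0 hΞC η₂ (δ / 2) hη₂pos (by positivity)
  refine ⟨r₀, hr₀, fun r hr hrlt => ?_⟩
  obtain ⟨lam₀', hlam₀', hsub⟩ := hsub r hr hrlt
  obtain ⟨Na, hkin⟩ := hkin (max lam₀ lam₀') (le_max_left _ _)
  obtain ⟨Nb, hsub⟩ := hsub (max lam₀ lam₀') (le_max_right _ _)
  refine ⟨max Na Nb, fun N hN => ?_⟩
  have e1 := hkin N ((le_max_left _ _).trans hN)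
  have e2 := hsub N ((le_max_right _ _).trans hN)
  dsimp only at e1 e2 ⊢
  have h := measure_deficit_le_add (Literature.MathematicalPhysics.KineticTheory.localGibbsLaw σ a₀ u₀ θ₀ N (Φ N)) _ _ _
    hgk.le hCd hs hsplit e1 e2
  refine h.trans ?_
  rw [← ENNReal.ofReal_add (by positivity) (by positivity), add_halves]

/-! ## §8 THE SKELETON THEOREM -/

/-- **`RateFloor_of` — the crux from the six registered stubs** (kernel-checked composition; hypotheses by stub name):
S3♭+S3+S4+S5 ⇒ entropy-class cut kinetic floor ⇒ (entropy budget) cut kinetic floor ⇒ (S2) `RateFloorKinetic` ⇒ (S1, c4's split)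
`RateFloor`. [folklore] -/
theorem RateFloor_of (h1 : Stubs.stub_subgridDomination) (h2 : Stubs.stub_denseComplementKinetic)
    (h3b : Stubs.stub_finiteEntropyDynamics) (h3 : Stubs.stub_stationaryLimit) (h4 : Stubs.stub_functionalLimits)
    (h5 : Stubs.stub_noScreening) : RateFloor := by
  obtain ⟨η₀, hη₀, g₀, hg₀, hE⟩ := entropyClassCutRateFloorKinetic_of_stationary h3b h3 h4 h5
  exact rateFloor_of_kinetic_of_subgrid
    (rateFloorKinetic_of_cut_of_dense hg₀ hη₀ (cutRateFloorKinetic_of_entropyClass hE) h2) h1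

end Summit.AtomisticToContinuum.HydrodynamicLimit.Cruxes.RateFloor.StationaryLimitNoScreening

end
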